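import Literature.NumberTheory.EllipticCurves.SelmerCorankAssembly
import Literature.NumberTheory.EllipticCurves.GoodReductionUnramifiedProofs
import Literature.NumberTheory.EllipticCurves.IwasawaTowerTorsionOrdinaryProofs
import Literature.NumberTheory.GaloisRepresentations.DecompositionGroupOfCompletion
import Mathlib.Algebra.Ring.Action.Submonoid
import Literature.NumberTheory.EllipticCurves.SelmerFiniteProofs
import Literature.NumberTheory.EllipticCurves.KodairaNeronUnramifiedInertiaProofs
import Literature.NumberTheory.EllipticCurves.PeriodIndexCorestrictionLocal
import Literature.NumberTheory.EllipticCurves.SelmerGroupOverTorsionFinite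
import Literature.NumberTheory.EllipticCurves.GeomPointsGaloisModule
import Literature.NumberTheory.GaloisRepresentations.FrobeniusGeneration
import Literature.NumberTheory.GaloisRepresentations.CyclotomicCharacterFrobeniusProofs
import Literature.NumberTheory.EllipticCurves.IwasawaLocalKummerSkeletonProofs
import Literature.NumberTheory.EllipticCurves.SelmerCorankProofs
import Literature.NumberTheory.EllipticCurves.CyclotomicTowerLocalFrobeniusProofs
import Literature.NumberTheory.EllipticCurves.LocalFrobeniusGenerationProofs
import Literature.NumberTheory.EllipticCurves.GaloisActionProofs
import Literature.NumberTheory.EllipticCurves.CoatesGreenberg1996.GoodModelKernelH1Trivial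
import Literature.NumberTheory.EllipticCurves.Greenberg1999.KummerImageGoodOrdinaryModel
import Literature.NumberTheory.EllipticCurves.IwasawaSelmerSupersingularLocalProofs
import Literature.NumberTheory.EllipticCurves.Greenberg1999.KummerImageGoodOrdinary
import Literature.NumberTheory.EllipticCurves.GreenbergVatsal2000.LocalConditionAtP
import Literature.NumberTheory.EllipticCurves.CoatesGreenberg1996.GoodModelKernelH1OfDeeplyRamifiedProofs
import Literature.NumberTheory.EllipticCurves.Greenberg1999.KummerImageMultiplicativeTateProofs
import Literature.NumberTheory.EllipticCurves.RibetGoodLatticeExistsProofs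
import HarnessLib

/-!
# Greenberg LNM 1716 Prop. 2.4 at a good ordinary prime and the Greenberg–Vatsal local condition at p — three named facts HOLD (re-homed proofs)

**Greenberg, *Iwasawa theory for elliptic curves*, LNM 1716 (1999), §2 Prop. 2.4 (pp. 74–75: at a place of good ORDINARY
reduction above `p`, over every layer of the cyclotomic tower, `Im λ_K ⊆ Im κ_K` — strict Greenberg classes are Kummer) and
Greenberg–Vatsal, Invent. Math. 142 (2000), §2 (p. 16: the local condition `L_𝔭`; p. 26) — THREE named facts of the tree HOLD,
EXACT names: `Literature.NumberTheory.EllipticCurves.Greenberg1999.imKummer_ge_strictCondition_goodOrdinary_holds`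
(`KummerImageGoodOrdinary.lean`), `…Greenberg1999.imKummer_ge_strictCondition_goodOrdinaryModel_holds`
(`KummerImageGoodOrdinaryModel.lean`), `Literature.NumberTheory.EllipticCurves.GreenbergVatsal2000.imKummer_ge_greenbergCondition_at_p_holds`
(`GreenbergVatsal2000/LocalConditionAtP.lean`).**  The mathematics: Coates–Greenberg 1996 (Cor. 3.2, Prop. 4.3: `H¹(K, Ê) = 0`
for the formal group of a good model over a deeply ramified field — in the tree the PROVED theorem
`CoatesGreenberg1996.H1_goodModelKernel_trivial_holds`, `GoodModelKernelH1OfDeeplyRamifiedProofs.lean`, Tate's almost étale lemma)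
gives Kummer = strict for a good ordinary model and for `E/ℚ` (Parts `GoodModelKummerOfCoatesGreenberg`,
`PublishedInputsGreenbergKummerImageHolds`); the Greenberg–Vatsal inertia form at `p` follows from the strict form through the
structure of the unramified quotient `E[p^∞]/C` over the decomposition group (Frobenius layers, divisibility, a cochain lemma;
Parts `GreenbergVatsalStrictCore`, `…StrictAtPQuotient`, `…StrictAtP`, `GreenbergConditionOfStrictCondition`) [GreenbergLNM1716]
[GreenbergVatsal2000] [CoatesGreenberg1996].
RE-HOMED into `Literature/` by the Hodge foundations lane (`lit-hodgefound`, seat p20, generation 40): verbatim DECLARATION-LEVEL ports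
(the 34 declarations needed, in dependency order) of `Summits/BirchSwinnertonDyer/Rank1Residual/X2/GreenbergVatsal{TorsionCurve (1
declaration), SelmerLink (1), UnramifiedAway (1), StrictCore (4), StrictAtPQuotient (16), StrictAtP (1)}`,
`Summits/BirchSwinnertonDyer/Rank1Residual/Additive/GoodModelKummerOfCoatesGreenberg (3)`,
`Summits/BirchSwinnertonDyer/Rank1Residual/GaloisImage/GreenbergConditionOfStrictCondition (4)`,
`Summits/BirchSwinnertonDyer/BirchSwinnertonDyer/Theorems/PublishedInputsGreenberg{KummerImageHolds (2), VatsalLocalConditionAtPHolds (1)}`;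
namespaces re-rooted as in the earlier Greenberg/Coates–Greenberg re-homings of this lane: `…Rank1Residual.X2.*` →
`Literature.NumberTheory.EllipticCurves.Greenberg1999.*`, `…Rank1Residual.Additive.GoodModelLine` →
`Literature.NumberTheory.EllipticCurves.CoatesGreenberg1996.GoodModelLine`, `…GaloisImage.GreenbergConditionOfStrictCondition` →
`Literature.NumberTheory.EllipticCurves.GreenbergVatsal2000.GreenbergConditionOfStrictCondition`, the two `Theorems.Inputs…` namespaces
→ the facts' own namespaces (so the three `_holds` theorems carry the EXACT names).  Already re-homed dependencies are USED, not
re-declared: `CoatesGreenberg1996.H1_goodModelKernel_trivial_holds` and the `GoodModelLine.{AlmostEtale,KernelH1}` layer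
(`GoodModelKernelH1OfDeeplyRamifiedProofs.lean`, `GoodModelFormalH1AlmostEtale.lean`),
`Greenberg1999.GreenbergVatsalSelmerLink.oneCocycleClass_mem_localKerOver_iff` (`KummerImageMultiplicativeTateProofs.lean`), the
reduction datum `RibetGoodLattice.GreenbergVatsalReductionDatum.{specVal, localRed, reductionDatum, …}` (`RibetGoodLatticeExistsProofs.lean`).
Theorem-only file: no definition, no new named fact (D-0026); imports Mathlib/Literature only; every declaration carries the citation
of the printed statement it formalises or serves.  The Summits originals stay in place (transitional duplication).  WHAT THIS IS NOT:
nothing here bears on BSD; these are local Galois-cohomology statements about elliptic curves with good ordinary reduction.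
-/

noncomputable section

/-!
## Part 1 — port of `Summits/BirchSwinnertonDyer/Rank1Residual/X2/GreenbergVatsalTorsionCurve.lean` (1 declarations kept)

# The geometric points of an elliptic curve over an algebraically closed field form a divisible group

Declarations of this Part (verbatim port; each keeps its own docstring and citation): `divisible_curve`.

Reference keys (see `references.bib` and the declarations' citations): [SilvermanAEC2009], [GreenbergVatsal2000], [GreenbergLNM1716].
-/

section Part1

open scoped _root_.Classical AddSubgroup

open _root_.NumberField _root_.IsDedekindDomain _root_.Field
open Literature.NumberTheory.EllipticCurves Literature.NumberTheory.EllipticCurves.GreenbergSelmer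
  Literature.NumberTheory.GaloisRepresentations

universe u

namespace Literature.NumberTheory.EllipticCurves.Greenberg1999.GreenbergVatsalTorsionCurve

/-! ## §1. `invariants = FixedPoints.addSubgroup` -/

section Hypotheses

variable {K : Type u} [Field K] [NumberField K] (W : WeierstrassCurve K) [W.IsElliptic]
  (p : ℕ) [Fact p.Prime]

omit [NumberField K] in
/-- `hdiv` for `E[p^∞]`: `E[p^∞]` is `p`-divisible (tree: `exists_nsmul_eq_geomPrimaryTorsion` with
`zsmul_geomPoints_surjective_holds`, Silverman III.4.2).
[cite: SilvermanAEC2009, Prop. III.4.2(a)] -/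
theorem divisible_curve (m : W.geomPrimaryTorsion p) : ∃ m' : W.geomPrimaryTorsion p, p • m' = m :=
  W.exists_nsmul_eq_geomPrimaryTorsion p W.zsmul_geomPoints_surjective_holds m

end Hypotheses

/-! ## §3. The comparison for `E[p^∞]` over any `L = K̄^H` -/

section Curve

variable {K : Type u} [Field K] [NumberField K] (W : WeierstrassCurve K) [W.IsElliptic]
  (p : ℕ) [Fact p.Prime] (H : Subgroup (absoluteGaloisGroup K)) [H.Normal]
  (L : Data K (W.geomPrimaryTorsion p) p) (S₀ : Set (HeightOneSpectrum (𝓞 K)))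

end Curve

/-! ## §4. Over `ℚ_∞` at a good ordinary `p`: the correction term is `#E(ℚ)[p]` -/

section Rat

variable (W : WeierstrassCurve ℚ) [W.IsElliptic] [W.IsGloballyMinimal] {p : ℕ} [Fact p.Prime]
  (κ : ZpExtension ℚ p) (L : Data ℚ (W.geomPrimaryTorsion p) p)
  (S₀ : Set (HeightOneSpectrum (𝓞 ℚ)))

end Rat

end Literature.NumberTheory.EllipticCurves.Greenberg1999.GreenbergVatsalTorsionCurve

end Part1

/-!
## Part 2 — port of `Summits/BirchSwinnertonDyer/Rank1Residual/X2/GreenbergVatsalSelmerLink.lean` (1 declarations kept)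

# Membership in the Greenberg local kernel (Greenberg–Vatsal 2000, §2: the condition L_𝔭)

Declarations of this Part (verbatim port; each keeps its own docstring and citation): `oneCocycleClass_mem_greenbergKer_iff`.

Reference keys (see `references.bib` and the declarations' citations): [SilvermanAEC2009], [GreenbergLNM1716], [GreenbergVatsal2000].
-/

section Part2

open scoped _root_.Classical AddSubgroup

open _root_.NumberField _root_.IsDedekindDomain _root_.Field
open Literature.NumberTheory.EllipticCurves Literature.NumberTheory.EllipticCurves.GreenbergSelmer
  Literature.NumberTheory.GaloisRepresentations

universe u

namespace Literature.NumberTheory.EllipticCurves.Greenberg1999.GreenbergVatsalSelmerLink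

variable {K : Type u} [Field K] [NumberField K]

/-! ## §1. Cocycle criteria for the local conditions of `S^{Σ₀}_M(L)` -/

section Criteria

variable (H : Subgroup (absoluteGaloisGroup K)) (M : Type u) [AddCommGroup M]
  [DistribMulAction (absoluteGaloisGroup K) M] [TopologicalSpace M] [DiscreteTopology M]

/-- **Cocycle criterion for Greenberg's condition at `v ∣ p`**: the class of `f` lies in
`N.greenbergKer H` iff `f mod M⁺_v` is principal on `H ⊓ I_v` with values in `M/M⁺_v`.
[cite: GreenbergVatsal2000, §2 p. 16 (membership in the Greenberg local kernel L_𝔭; helper)] -/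
theorem oneCocycleClass_mem_greenbergKer_iff {v : HeightOneSpectrum (𝓞 K)} (N : LocalDatum K M v)
    (f : contOneCocycles (discreteTopRep H M)) :
    oneCocycleClass (discreteTopRep H M) f ∈ N.greenbergKer H ↔
      ∃ q : N.Gr, ∀ x : inertiaIn H v, N.grMk (f.1 (inertiaInToH H v x)) = x • q - q := by
  rw [LocalDatum.mem_greenbergKer_iff, LocalDatum.greenbergMap, resH1Hom_oneCocycleClass,
    oneCocycleClass_eq_zero_iff]
  rfl

end Criteria

/-! ## §2. The classical (Kummer) local condition, on cocycles -/

section Kummer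

variable (W : WeierstrassCurve K) (p : ℕ) (H : Subgroup (absoluteGaloisGroup K))
  (E : Type u) [Field E] [Algebra K E]

end Kummer

/-! ## §3. Away from `p`: the classical condition at a good `v ∤ p` forces "unramified over `L`" -/

section Away

variable (W : WeierstrassCurve K) [W.IsElliptic] (p : ℕ) [Fact p.Prime]
  (H : Subgroup (absoluteGaloisGroup K))

end Away

/-! ## §4. At `v ∣ p`: the classical condition forces Greenberg's condition, for data satisfying
the Kummer compatibility -/

section AtP

variable (W : WeierstrassCurve K) (p : ℕ) (H : Subgroup (absoluteGaloisGroup K))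

end AtP

/-! ## §5. The link: `Sel_{p^∞}(E/L) ≤ S^{Σ₀}_{E[p^∞]}(L)` and `Sel_{p^∞}(E/K_∞) ≤ S^{Σ₀}_{E[p^∞]}(K_∞)` -/

section Link

variable (W : WeierstrassCurve K) [W.IsElliptic] (p : ℕ) [Fact p.Prime]
  (H : Subgroup (absoluteGaloisGroup K)) [H.Normal]
  (L : Data K (W.geomPrimaryTorsion p) p) (S₀ : Set (HeightOneSpectrum (𝓞 K)))

end Link

end Literature.NumberTheory.EllipticCurves.Greenberg1999.GreenbergVatsalSelmerLink

end Part2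

/-!
## Part 3 — port of `Summits/BirchSwinnertonDyer/Rank1Residual/X2/GreenbergVatsalUnramifiedAway.lean` (1 declarations kept)

# Conjugation by the decomposition group preserves inertia

Declarations of this Part (verbatim port; each keeps its own docstring and citation): `conj_mem_inertia_of_mem_decompositionSubgroup`.

Reference keys (see `references.bib` and the declarations' citations): [GreenbergVatsal2000], [GreenbergLNM1716], [Washington1997], [SerreAbelianLadic1968].
-/

section Part3

open scoped _root_.Classical _root_.Pointwise

universe u

namespace Literature.NumberTheory.EllipticCurves.Greenberg1999.GreenbergVatsalUnramifiedAway

open Literature.NumberTheory.GaloisRepresentations Literature.NumberTheory.EllipticCurves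
  Literature.NumberTheory.EllipticCurves.ResKernel

/-! ## §1. Number fields: unramified classes at a good `v ∤ p` are locally trivial over `K_∞` -/

section NumberField

open _root_.NumberField _root_.IsDedekindDomain _root_.Field Literature.NumberTheory.EllipticCurves.GreenbergSelmer
  Literature.NumberTheory.EllipticCurves.Greenberg1999.GreenbergVatsalTorsionCurve

variable {K : Type u} [Field K] [NumberField K]

/-- `I_{𝔓}` is normalised by `D_{𝔓}` (Mathlib: the inertia subgroup is normal in the stabiliser).
[cite: NeukirchANT1999, Ch. I §9 (inertia is normal in the decomposition group; helper)] -/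
theorem conj_mem_inertia_of_mem_decompositionSubgroup {G R : Type*} [Group G] [CommRing R]
    [MulSemiringAction G R] (P : Ideal R) {g i : G} (hg : g ∈ P.decompositionSubgroup G)
    (hi : i ∈ P.inertia G) : g * i * g⁻¹ ∈ P.inertia G := by
  rw [AddSubgroup.mem_inertia] at hi ⊢
  intro x
  rw [Submodule.mem_toAddSubgroup, ← Ideal.smul_mem_pointwise_smul_iff (a := g⁻¹), smul_sub,
    smul_smul, ← mul_assoc, inv_mul_cancel_left, mul_smul,
    (MulAction.stabilizer G P).inv_mem (Ideal.mem_decompositionSubgroup_iff.mp hg)]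
  exact hi (g⁻¹ • x)

variable {p : ℕ} [Fact p.Prime] (κ : ZpExtension K p) (v : HeightOneSpectrum (𝓞 K))

variable (W : WeierstrassCurve K) [W.IsElliptic] (p)

end NumberField

/-! ## §2. The cyclotomic `ℤ_p`-extension: every `v ∤ p` is unramified and no `v ∤ p` splits
completely -/

section Cyclotomic

open _root_.NumberField _root_.IsDedekindDomain _root_.Field Literature.NumberTheory.EllipticCurves.GreenbergSelmer
  Literature.NumberTheory.EllipticCurves.Greenberg1999.GreenbergVatsalTorsionCurve

variable {K : Type} [Field K] [NumberField K] {p : ℕ} [Fact p.Prime] (κ : ZpExtension K p)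
  (v : HeightOneSpectrum (𝓞 K))

variable (W : WeierstrassCurve K) [W.IsElliptic] (p)

end Cyclotomic

end Literature.NumberTheory.EllipticCurves.Greenberg1999.GreenbergVatsalUnramifiedAway

end Part3

/-!
## Part 4 — port of `Summits/BirchSwinnertonDyer/Rank1Residual/X2/GreenbergVatsalStrictCore.lean` (4 declarations kept)

# Cochain and cardinality helpers for the strict local condition (Greenberg LNM 1716, §2)

Declarations of this Part (verbatim port; each keeps its own docstring and citation): `exists_eq_smul_sub_of_vanishing_on_inertia_of_surjective`, `natCard_quotient_range_eq_natCard_ker`, `natCard_ker_nsmul_mem_map`, `surjective_of_finite_ker_of_divisible`.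

Reference keys (see `references.bib` and the declarations' citations): [GreenbergLNM1716], [SerreGaloisCohomology1997].
-/

section Part4

open scoped _root_.Classical _root_.Pointwise

universe u

namespace Literature.NumberTheory.EllipticCurves.Greenberg1999.GreenbergVatsalStrictCore

open Literature.NumberTheory.GaloisRepresentations Literature.NumberTheory.EllipticCurves
  Literature.NumberTheory.EllipticCurves.ResKernel

/-! ## §1. The totally ramified case: a Frobenius inside `P` -/

section Cocycle

variable {G : Type u} [Group G] [TopologicalSpace G] [IsTopologicalGroup G] [CompactSpace G]
  [TotallyDisconnectedSpace G]
variable {D : Type u} [AddCommGroup D] [DistribMulAction G D] [TopologicalSpace D]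
  [DiscreteTopology D]
variable {p : ℕ} [Fact p.Prime]

/-- **`H¹(P/(P ∩ I), D) = 0` in the totally ramified case.** Let `G` be a profinite group,
`I ≤ G` a subgroup normalised by `G`, `κ : G → ℤ_p` a homomorphism with kernel `P`, `φ ∈ P` such
that `G = φ^ℕ · I · U` for every open subgroup `U` (Frobenius generation), such that for every open
normal `U` there is `B` with `κ(U ∩ I) ⊇ κ(G) ∩ p^B ℤ_p` (`hopen`; "the inertia group surjects onto
`Gal(K_∞/K)`") and `κ ≡ 0 (mod p^B)` on some open subgroup for each `B` (`hlayer`). Let `D` be a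
discrete `G`-module with continuous orbit maps on which `I` acts trivially and `φ − 1` is
surjective. Then every continuous `1`-cocycle of `P` with values in `D` vanishing on `P ∩ I` is a
coboundary. (Serre, *Local Fields* XIII §1: `H¹(Ẑ, A) = A/(F − 1)A`; Greenberg 1999 p. 73.)
[cite: GreenbergLNM1716, §2 p. 73] [cite: SerreGaloisCohomology1997, I §5.1] -/
theorem exists_eq_smul_sub_of_vanishing_on_inertia_of_surjective {I P : Subgroup G}
    (hIn : ∀ g : G, ∀ i ∈ I, g * i * g⁻¹ ∈ I) {φ : G} (hφP : φ ∈ P)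
    (hdec : ∀ U : Subgroup G, IsOpen (U : Set G) → ∀ d : G,
      ∃ (n : ℕ) (i u : G), i ∈ I ∧ u ∈ U ∧ d = φ ^ n * i * u)
    (κ : G →* Multiplicative ℤ_[p]) (hP : ∀ {x : G}, x ∈ P ↔ κ x = 1)
    (hopen : ∀ U : Subgroup G, U.Normal → IsOpen (U : Set G) → ∃ B : ℕ, ∀ u : G,
      (p : ℤ_[p]) ^ B ∣ (κ u).toAdd → ∃ w ∈ U, w ∈ I ∧ κ w = κ u)
    (hlayer : ∀ B : ℕ, ∃ V : Subgroup G, IsOpen (V : Set G) ∧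
      ∀ v ∈ V, (p : ℤ_[p]) ^ B ∣ (κ v).toAdd)
    (hcont : ∀ d : D, Continuous fun g : G ↦ g • d)
    (hID : ∀ i ∈ I, ∀ d : D, i • d = d) (hsurj : ∀ d : D, ∃ d' : D, φ • d' - d' = d)
    (g : contOneCocycles (discreteTopRep P D)) (hg : ∀ x : P, (x : G) ∈ I → g.1 x = 0) :
    ∃ b : D, ∀ x : P, g.1 x = (x : G) • b - b := by
  have _ := hIn
  obtain ⟨d, hd⟩ := hsurj (g.1 ⟨φ, hφP⟩)
  set cb : contOneCocycles (discreteTopRep P D) :=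
    cobCocycle d ((hcont d).comp continuous_subtype_val) with hcb
  have hδ : ∀ x : P, (g - cb).1 x = g.1 x - ((x : G) • d - d) := fun x ↦ by
    rw [Submodule.coe_sub, ContinuousMap.sub_apply]; rfl
  set Z := zeroSubgroup (g - cb) with hZ
  have hZφ : (⟨φ, hφP⟩ : P) ∈ Z := by
    rw [mem_zeroSubgroup_iff, hδ, ← hd]; exact sub_self _
  have hZI : ∀ x : P, (x : G) ∈ I → x ∈ Z := fun x hx ↦ by
    rw [mem_zeroSubgroup_iff, hδ, hg x hx, hID _ hx d, sub_self, sub_zero]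
  -- an open normal `U` with `U ∩ P ⊆ Z`
  have hz : IsOpen (Z : Set P) := isOpen_zeroSubgroup _
  obtain ⟨O, hO, hOeq⟩ := isOpen_induced_iff.mp hz
  have h1O : (1 : G) ∈ O := by
    have : (1 : P) ∈ Subtype.val ⁻¹' O := by rw [hOeq]; exact Z.one_mem
    exact this
  obtain ⟨Un, hUn⟩ := ProfiniteGrp.exist_openNormalSubgroup_sub_open_nhds_of_one hO h1O
  have hUZ : ∀ x : P, (x : G) ∈ (Un : Set G) → x ∈ Z := fun x hx ↦ by
    have : x ∈ Subtype.val ⁻¹' O := hUn hx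
    rw [hOeq] at this
    exact this
  obtain ⟨B, hB⟩ := hopen Un.toSubgroup inferInstance Un.isOpen
  obtain ⟨V, hV, hVB⟩ := hlayer B
  refine ⟨d, fun x ↦ ?_⟩
  suffices hxZ : x ∈ Z by
    rw [mem_zeroSubgroup_iff, hδ, sub_eq_zero] at hxZ; exact hxZ
  obtain ⟨n, i, u, hi, hu, hx⟩ := hdec (Un.toSubgroup ⊓ V) (Un.isOpen.inter hV) x
  obtain ⟨huU, huV⟩ := Subgroup.mem_inf.1 hu
  obtain ⟨w, hwU, hwI, hκw⟩ := hB u (hVB u huV)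
  -- `κ i * κ u = 1`
  have hκx : κ x = 1 := hP.1 x.2
  have hκφ : κ φ = 1 := hP.1 hφP
  have hκiu : κ i * κ u = 1 := by
    have h := congrArg κ hx
    rw [hκx, map_mul, map_mul, map_pow, hκφ, one_pow, one_mul] at h
    exact h.symm
  -- re-split `i u = i' u'` with `i' = i w ∈ P ∩ I`, `u' = w⁻¹ u ∈ P ∩ U`
  have hi'P : i * w ∈ P := hP.2 (by rw [map_mul, hκw, hκiu])
  have hu'P : w⁻¹ * u ∈ P := hP.2 (by rw [map_mul, map_inv, hκw, inv_mul_cancel])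
  have hi'Z : (⟨i * w, hi'P⟩ : P) ∈ Z := hZI _ (I.mul_mem hi hwI)
  have hu'Z : (⟨w⁻¹ * u, hu'P⟩ : P) ∈ Z := hUZ _ (Un.toSubgroup.mul_mem (Un.toSubgroup.inv_mem hwU) huU)
  have e : x = ⟨φ, hφP⟩ ^ n * ⟨i * w, hi'P⟩ * ⟨w⁻¹ * u, hu'P⟩ := by
    apply Subtype.ext
    simp only [Subgroup.coe_mul, SubgroupClass.coe_pow]
    rw [hx]; group
  rw [e]
  exact Z.mul_mem (Z.mul_mem (Z.pow_mem hZφ n) hi'Z) hu'Z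

end Cocycle

/-! ## §2. Endomorphisms with finite kernel of divisible `p`-primary groups are surjective -/

section Surjective

variable {D : Type u} [AddCommGroup D] {p : ℕ} [Fact p.Prime]

/-- In a finite abelian group `A`, for an endomorphism `f`, `#(A ⧸ f(A)) = #ker f`. [cite: GreenbergLNM1716, §2 Props. 2.2–2.4 (cochain/cardinality helpers for the strict local condition)] -/
theorem natCard_quotient_range_eq_natCard_ker {A : Type*} [AddCommGroup A] [Finite A] (f : A →+ A) :
    Nat.card (A ⧸ f.range) = Nat.card f.ker := by
  have h1 := AddSubgroup.card_eq_card_quotient_mul_card_addSubgroup f.ker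
  have h2 := AddSubgroup.card_eq_card_quotient_mul_card_addSubgroup f.range
  have h3 : Nat.card (A ⧸ f.ker) = Nat.card f.range :=
    Nat.card_congr (QuotientAddGroup.quotientKerEquivRange f).toEquiv
  rw [h3] at h1
  have hpos : 0 < Nat.card f.range := Nat.card_pos
  have : Nat.card (A ⧸ f.range) * Nat.card f.range = Nat.card f.ker * Nat.card f.range := by
    rw [← h2, h1, mul_comm]
  exact Nat.eq_of_mul_eq_mul_right hpos this

/-- **`#ker f · a ∈ f(D)` for every `a` of finite additive order dividing... in a finite `f`-stable
subgroup**: if `A ≤ D` is a finite subgroup with `f(A) ⊆ A`, then `#(ker f) • a ∈ f(A)` for all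
`a ∈ A`. [cite: GreenbergLNM1716, §2 Props. 2.2–2.4 (cochain/cardinality helpers for the strict local condition)] -/
theorem natCard_ker_nsmul_mem_map (f : D →+ D) [Finite f.ker] (A : AddSubgroup D) [Finite A]
    (hA : ∀ a ∈ A, f a ∈ A) (a : D) (ha : a ∈ A) :
    ∃ a' ∈ A, f a' = Nat.card f.ker • a := by
  -- the restriction `fA : A →+ A`
  set fA : A →+ A := (f.restrict A).codRestrict A (fun x ↦ hA x x.2) with hfA
  have hfA_apply : ∀ x : A, ((fA x : A) : D) = f x := fun x ↦ rfl
  -- `#(A/fA(A)) = #ker fA ∣ #ker f`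
  have hq := natCard_quotient_range_eq_natCard_ker fA
  have hdvd : Nat.card fA.ker ∣ Nat.card f.ker := by
    refine AddSubgroup.card_dvd_of_injective
      ((A.subtype.comp fA.ker.subtype).codRestrict f.ker fun x ↦ ?_) ?_
    · rw [AddMonoidHom.mem_ker, AddMonoidHom.comp_apply, AddSubgroup.subtype_apply,
        AddSubgroup.subtype_apply, ← hfA_apply, (AddMonoidHom.mem_ker).1 x.2, ZeroMemClass.coe_zero]
    · intro x y hxy
      have h := congrArg Subtype.val hxy
      exact Subtype.ext (Subtype.ext h)
  obtain ⟨c, hc⟩ := hdvd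
  -- `#(A/fA(A)) • (mk a) = 0`, i.e. `#ker fA • a ∈ fA(A)`
  have hmem : Nat.card fA.ker • (⟨a, ha⟩ : A) ∈ fA.range := by
    rw [← hq, ← QuotientAddGroup.eq_zero_iff, QuotientAddGroup.mk_nsmul]
    exact card_nsmul_eq_zero'
  obtain ⟨x, hx⟩ := hmem
  refine ⟨((c • x : A) : D), (c • x).2, ?_⟩
  rw [hc, mul_comm, mul_nsmul', ← hfA_apply, map_nsmul]
  rw [hx]
  rfl

/-- **An additive endomorphism with finite kernel of a `p`-divisible `p`-primary group with finite
`p^k`-torsion is surjective** (`D ≅ (ℚ_p/ℤ_p)^r`: such `f` has finite cokernel, which is divisible,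
hence zero). Proof without structure theory: `#ker f · D[p^m] ⊆ f(D)` for every `m`
(`natCard_ker_nsmul_mem_map`), and every `d` is `#ker f · a` for a torsion `a` (divisibility by
`p^c` and invertibility of the prime-to-`p` part of `#ker f` on `p`-power torsion). [cite: GreenbergLNM1716, §2 Props. 2.2–2.4 (cochain/cardinality helpers for the strict local condition)] -/
theorem surjective_of_finite_ker_of_divisible (f : D →+ D)
    (htor : ∀ d : D, ∃ k : ℕ, p ^ k • d = 0) (hdiv : ∀ d : D, ∃ d' : D, p • d' = d)
    (hfin : ∀ k : ℕ, Set.Finite {d : D | p ^ k • d = 0}) (hker : Set.Finite (f.ker : Set D)) :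
    Function.Surjective f := by
  haveI : Finite f.ker := hker.to_subtype
  set N₀ := Nat.card f.ker with hN₀
  have hN₀0 : N₀ ≠ 0 := Nat.card_pos.ne'
  obtain ⟨c, m', hm', hcm⟩ := Nat.exists_eq_pow_mul_and_not_dvd hN₀0 p (Fact.out : p.Prime).ne_one
  intro d
  -- `d = p^c • d₁`
  obtain ⟨d₁, rfl⟩ := exists_pow_smul_eq_of_forall_exists_smul_eq p hdiv c d
  obtain ⟨k, hk⟩ := htor d₁
  -- `m'` is invertible on `d₁`
  have hcop : Nat.Coprime m' (p ^ k) :=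
    (Nat.Coprime.pow_right k ((Nat.Prime.coprime_iff_not_dvd Fact.out).2 hm').symm)
  have hbez : (m' : ℤ) * Nat.gcdA m' (p ^ k) + ((p ^ k : ℕ) : ℤ) * Nat.gcdB m' (p ^ k) = 1 := by
    have h := Nat.gcd_eq_gcd_ab m' (p ^ k)
    rw [Nat.Coprime.gcd_eq_one hcop] at h
    exact_mod_cast h.symm
  set a : D := Nat.gcdA m' (p ^ k) • d₁ with ha
  have hm'a : m' • a = d₁ := by
    have h1 : d₁ = ((m' : ℤ) * Nat.gcdA m' (p ^ k)) • d₁ +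
        (((p ^ k : ℕ) : ℤ) * Nat.gcdB m' (p ^ k)) • d₁ := by rw [← add_smul, hbez, one_smul]
    have h2 : (((p ^ k : ℕ) : ℤ) * Nat.gcdB m' (p ^ k)) • d₁ = 0 := by
      rw [mul_comm, mul_smul, natCast_zsmul, hk, smul_zero]
    rw [h2, add_zero, mul_smul, natCast_zsmul] at h1
    rw [ha, ← h1]
  -- `a` is `p^k`-torsion, so lies in the finite `f`-stable subgroup `D[p^k]`
  set A : AddSubgroup D := (DistribSMul.toAddMonoidHom D (p ^ k)).ker with hA
  have hAmem : ∀ x : D, x ∈ A ↔ p ^ k • x = 0 := fun x ↦ by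
    rw [hA, AddMonoidHom.mem_ker, DistribSMul.toAddMonoidHom_apply]
  haveI : Finite A := by
    have e : (A : Set D) = {d : D | p ^ k • d = 0} := by ext x; exact hAmem x
    have hf := hfin k
    rw [← e] at hf
    exact hf.to_subtype
  have haA : a ∈ A := by
    rw [hAmem, ha, smul_comm, hk, smul_zero]
  have hfA : ∀ x ∈ A, f x ∈ A := fun x hx ↦ by
    rw [hAmem] at hx ⊢
    rw [← map_nsmul, hx, map_zero]
  obtain ⟨a', -, ha'⟩ := natCard_ker_nsmul_mem_map f A hfA a haA
  refine ⟨a', ?_⟩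
  rw [ha', ← hN₀, hcm, mul_comm, mul_nsmul', smul_comm, hm'a]

end Surjective

end Literature.NumberTheory.EllipticCurves.Greenberg1999.GreenbergVatsalStrictCore

end Part4

/-!
## Part 5 — port of `Summits/BirchSwinnertonDyer/Rank1Residual/X2/GreenbergVatsalStrictAtPQuotient.lean` (16 declarations kept)

# The unramified quotient `E[p^∞]/C` at the place above `p`: decomposition group, Frobenius layers, divisibility (Greenberg–Vatsal 2000, §2)

Declarations of this Part (verbatim port; each keeps its own docstring and citation): `isClosed_decomp`, `compactSpace_decomp`, `continuous_toDecomp`, `exists_eq_frob_pow_mul_of_decomp`, `exists_mem_inertia_kappa_eq`, `exists_layer_le_kappa_inertia`, `exists_open_layer`, `continuous_smul_gr`, `grMk_eq_grMk_iff`, `smul_gr_eq_of_mem_inertia`, `grMk_eq_grMk_of_localRed_eq`, `smul_grMk_eq_iff`, `finite_fixed_frob`, `finite_torsionBy_gr`, `divisible_and_primary_gr`, `exists_frob_smul_sub_eq`.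

Reference keys (see `references.bib` and the declarations' citations): [NeukirchANT1999], [SerreLocalFields1979], [Washington1997], [GreenbergVatsal2000], [GreenbergLNM1716], [SilvermanAEC2009].
-/

section Part5

open scoped _root_.Classical _root_.NNReal

universe u

namespace Literature.NumberTheory.EllipticCurves.Greenberg1999.GreenbergVatsalStrictAtPQuotient

open _root_.NumberField _root_.IsDedekindDomain _root_.Field Literature.NumberTheory.GaloisRepresentations
  Literature.NumberTheory.EllipticCurves Literature.NumberTheory.EllipticCurves.GreenbergSelmer
  Literature.NumberTheory.EllipticCurves.ResKernel
  Literature.NumberTheory.EllipticCurves.RibetGoodLattice.GreenbergVatsalReductionDatum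
  Literature.NumberTheory.EllipticCurves.Greenberg1999.GreenbergVatsalStrictCore

/-! ## §1. The decomposition group `D_v` as a profinite group; local Frobenius generation inside it -/

section Decomp

variable {K : Type u} [Field K] [NumberField K] (v : HeightOneSpectrum (𝓞 K))

/-- `D_v` is closed in `Γ_K`. [cite: GreenbergVatsal2000, §2 p. 26 with GreenbergLNM1716, §2 Prop. 2.4 (the unramified quotient E[p^∞]/C at p: topology of the decomposition group, Frobenius layers, divisibility)] -/
theorem isClosed_decomp :
    IsClosed ((decomp (K := K) v : Subgroup (absoluteGaloisGroup K)) : Set (absoluteGaloisGroup K)) := by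
  have hDeq : decomp v = (adicCompletionPrime K v).decompositionSubgroup (absoluteGaloisGroup K) :=
    (decompositionSubgroup_adicCompletionPrime_eq_range K v).symm
  rw [hDeq]
  exact absIntegers.isClosed_decompositionSubgroup_holds (R := 𝓞 K) (adicCompletionPrime K v)

/-- `D_v` is compact. [cite: GreenbergVatsal2000, §2 p. 26 with GreenbergLNM1716, §2 Prop. 2.4 (the unramified quotient E[p^∞]/C at p: topology of the decomposition group, Frobenius layers, divisibility)] -/
theorem compactSpace_decomp : CompactSpace (decomp (K := K) v) :=
  isCompact_iff_compactSpace.mp (isClosed_decomp v).isCompact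

/-- The local restriction map `Γ_{K_v} → D_v` (range-restricted) is continuous. [cite: GreenbergVatsal2000, §2 p. 26 with GreenbergLNM1716, §2 Prop. 2.4 (the unramified quotient E[p^∞]/C at p: topology of the decomposition group, Frobenius layers, divisibility)] -/
theorem continuous_toDecomp :
    Continuous fun σ : absoluteGaloisGroup (v.adicCompletion K) ↦
      (⟨absGaloisRestrict K (v.adicCompletion K) σ, ⟨σ, rfl⟩⟩ : decomp (K := K) v) :=
  (absGaloisRestrict K (v.adicCompletion K)).continuous.subtype_mk _

/-- **Local Frobenius generation inside `D_v`**: for an arithmetic Frobenius `τ ∈ Γ_{K_v}` at a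
prime `𝔐` of `\bar 𝓞_v` (spectral valuation `w`), every element of `D_v` is
`(res τ)ⁿ · i · u` with `i ∈ I_v` and `u` in any prescribed open subgroup of `D_v`
(`exists_eq_frobenius_pow_mul_inertia_mul` pushed along `res : Γ_{K_v} ↠ D_v`, with
`I_𝔐 = I_{K_v}`, `inertia_eq_absInertia`). [cite: NeukirchANT1999, Ch. II §9 Prop. (9.9)–(9.11)] -/
theorem exists_eq_frob_pow_mul_of_decomp
    {w : Valuation (AlgebraicClosure (v.adicCompletion K)) ℝ≥0}
    (hw : ∀ x, (w x : ℝ) =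
      spectralNorm (v.adicCompletion K) (AlgebraicClosure (v.adicCompletion K)) x)
    {𝔐 : Ideal v.localAbsIntegers} (h𝔐 : 𝔐 ∈ v.localPrimesAbove)
    {τ : absoluteGaloisGroup (v.adicCompletion K)}
    (hτ : IsArithFrobAt (v.adicCompletionIntegers K) τ 𝔐)
    (U : Subgroup (decomp (K := K) v)) (hU : IsOpen (U : Set (decomp (K := K) v)))
    (d : decomp (K := K) v) :
    ∃ (n : ℕ) (i u : decomp (K := K) v), (i : absoluteGaloisGroup K) ∈ inertia v ∧ u ∈ U ∧
      d = ⟨absGaloisRestrict K (v.adicCompletion K) τ, ⟨τ, rfl⟩⟩ ^ n * i * u := by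
  let r : absoluteGaloisGroup (v.adicCompletion K) →* decomp (K := K) v :=
    { toFun := fun σ ↦ ⟨absGaloisRestrict K (v.adicCompletion K) σ, ⟨σ, rfl⟩⟩
      map_one' := Subtype.ext (map_one _)
      map_mul' := fun a b ↦ Subtype.ext (map_mul _ a b) }
  have hr : ∀ σ, ((r σ : decomp (K := K) v) : absoluteGaloisGroup K) =
      absGaloisRestrict K (v.adicCompletion K) σ := fun _ ↦ rfl
  have hUo : IsOpen ((U.comap r : Subgroup (absoluteGaloisGroup (v.adicCompletion K))) :
      Set (absoluteGaloisGroup (v.adicCompletion K))) :=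
    hU.preimage (continuous_toDecomp v)
  obtain ⟨σ, hσ⟩ := (mem_decomp_iff v (d : absoluteGaloisGroup K)).1 d.2
  obtain ⟨n, ι, u, hι, hu, hdec⟩ := v.exists_eq_frobenius_pow_mul_inertia_mul h𝔐 hτ hUo σ
  refine ⟨n, r ι, r u, ?_, hu, ?_⟩
  · rw [IsDedekindDomain.HeightOneSpectrum.inertia_eq_absInertia hw h𝔐] at hι
    exact ⟨ι, hι, rfl⟩
  · apply Subtype.ext
    simp only [Subgroup.coe_mul, SubgroupClass.coe_pow, hr]
    rw [← hσ, hdec, map_mul, map_mul, map_pow]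

end Decomp

/-! ## §2. The cyclotomic tower over `ℚ` at `p`: inertia fills every layer -/

section Layers

variable {p : ℕ} [hp : Fact p.Prime] (κ : ZpExtension ℚ p) (v : HeightOneSpectrum (𝓞 ℚ))

/-- **`κ(I_v) = Gal(ℚ_∞/ℚ)` at `v ∋ p` for the cyclotomic tower**: every value of `κ` is taken on
the inertia group `I_v` (from `χ_p(I_{𝔓₀}) = ℤ_pˣ`, tree `exists_mem_inertia_cyclotomicCharacter_eq`,
and `ker κ = χ_p⁻¹(μ(ℤ_p))`). [cite: SerreLocalFields1979, Ch. IV §4 Prop. 17]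
[cite: Washington1997, §13.1] -/
theorem exists_mem_inertia_kappa_eq (hκ : κ.IsCyclotomic) (hpv : ((p : ℕ) : 𝓞 ℚ) ∈ v.asIdeal)
    (t : Multiplicative ℤ_[p]) :
    ∃ y ∈ inertia v, κ y = t := by
  obtain ⟨g, rfl⟩ := κ.surjective t
  have hv : (Rat.HeightOneSpectrum.primesEquiv v : ℕ) = p :=
    Rat.HeightOneSpectrum.primesEquiv_eq_of_natCast_mem v hp.out hpv
  obtain ⟨y, hy, hχ⟩ := Literature.NumberTheory.EllipticCurves.exists_mem_inertia_cyclotomicCharacter_eq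
    p hv (adicCompletionPrime_mem_primesAbove ℚ v) (GaloisRep.cyclotomicCharacter ℚ p g)
  have hIeq : inertia v = (adicCompletionPrime ℚ v).inertia (absoluteGaloisGroup ℚ) :=
    (inertia_adicCompletionPrime_eq_map_absInertia ℚ v).symm
  refine ⟨y, by rw [hIeq]; exact hy, ?_⟩
  have hmem : y⁻¹ * g ∈ κ.kerSubgroup := by
    rw [hκ, Subgroup.mem_comap]
    change GaloisRep.cyclotomicCharacter ℚ p (y⁻¹ * g) ∈ CommGroup.torsion ℤ_[p]ˣ
    rw [map_mul, map_inv, hχ, inv_mul_cancel]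
    exact (CommGroup.torsion ℤ_[p]ˣ).one_mem
  rw [ZpExtension.mem_kerSubgroup, map_mul, map_inv, inv_mul_eq_one] at hmem
  exact hmem

/-- **Inertia fills the layers**: for every open normal subgroup `U` of `D_v` there is `B` such that
every value of `κ` divisible by `p^B` is `κ(w)` for some `w ∈ U ∩ I_v` (the `[I_v : I_v ∩ U]`-th
powers of `I_v` lie in `U`, and `κ(I_v) = ℤ_p`). [cite: GreenbergVatsal2000, §2 p. 26 with GreenbergLNM1716, §2 Prop. 2.4 (the unramified quotient E[p^∞]/C at p: topology of the decomposition group, Frobenius layers, divisibility)] -/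
theorem exists_layer_le_kappa_inertia (hκ : κ.IsCyclotomic) (hpv : ((p : ℕ) : 𝓞 ℚ) ∈ v.asIdeal)
    (U : Subgroup (decomp (K := ℚ) v)) [U.Normal] (hU : IsOpen (U : Set (decomp (K := ℚ) v))) :
    ∃ B : ℕ, ∀ u : decomp (K := ℚ) v,
      (p : ℤ_[p]) ^ B ∣ (κ (u : absoluteGaloisGroup ℚ)).toAdd →
        ∃ w ∈ U, (w : absoluteGaloisGroup ℚ) ∈ inertia v ∧
          κ (w : absoluteGaloisGroup ℚ) = κ (u : absoluteGaloisGroup ℚ) := by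
  -- `I₀ = I_v` inside `D_v`; `U ∩ I₀` has finite index `n` in `I₀`
  set I₀ : Subgroup (decomp (K := ℚ) v) := (inertia v).subgroupOf (decomp v) with hI₀
  haveI := compactSpace_decomp (K := ℚ) v
  haveI : Finite (decomp (K := ℚ) v ⧸ U) := Subgroup.quotient_finite_of_isOpen _ hU
  haveI hUfi : U.FiniteIndex := Subgroup.finiteIndex_of_finite_quotient
  haveI : (U.subgroupOf I₀).FiniteIndex := inferInstance
  haveI : (U.subgroupOf I₀).Normal := inferInstance
  set n := (U.subgroupOf I₀).index with hn
  have hn0 : n ≠ 0 := Subgroup.FiniteIndex.index_ne_zero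
  obtain ⟨B, m, hm, hnm⟩ := Nat.exists_eq_pow_mul_and_not_dvd hn0 p hp.out.ne_one
  obtain ⟨mu, hmu⟩ := IwasawaDual.isUnit_natCast_padicInt (p := p) hm
  refine ⟨B, fun u hu ↦ ?_⟩
  obtain ⟨c, hc⟩ := hu
  -- `κ u = n • s` with `s = m⁻¹ c`
  set s : ℤ_[p] := ((mu⁻¹ : ℤ_[p]ˣ) : ℤ_[p]) * c with hs
  have hns : (n : ℤ_[p]) * s = (κ (u : absoluteGaloisGroup ℚ)).toAdd := by
    rw [hc, hnm, Nat.cast_mul, Nat.cast_pow, ← hmu, hs]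
    rw [mul_assoc, ← mul_assoc (mu : ℤ_[p]), Units.mul_inv, one_mul]
  -- `y ∈ I_v` with `κ y = s`, and `w = y^n`
  obtain ⟨y, hyI, hκy⟩ := exists_mem_inertia_kappa_eq κ v hκ hpv (Multiplicative.ofAdd s)
  have hyD : y ∈ decomp v := inertia_le_decomp v hyI
  set y₀ : I₀ := ⟨⟨y, hyD⟩, (Subgroup.mem_subgroupOf).2 hyI⟩ with hy₀
  have hw : (y₀ ^ n : I₀) ∈ U.subgroupOf I₀ := Subgroup.pow_index_mem _ y₀
  refine ⟨⟨y, hyD⟩ ^ n, ?_, ?_, ?_⟩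
  · have := (Subgroup.mem_subgroupOf).1 hw
    simpa only [SubgroupClass.coe_pow] using this
  · rw [SubgroupClass.coe_pow]
    exact (inertia v).pow_mem hyI n
  · apply Multiplicative.toAdd.injective
    rw [SubgroupClass.coe_pow, map_pow, toAdd_pow, hκy, toAdd_ofAdd, nsmul_eq_mul, hns]

/-- The layers `κ⁻¹(p^B ℤ_p) ∩ D_v` are open in `D_v`. [cite: GreenbergVatsal2000, §2 p. 26 with GreenbergLNM1716, §2 Prop. 2.4 (the unramified quotient E[p^∞]/C at p: topology of the decomposition group, Frobenius layers, divisibility)] -/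
theorem exists_open_layer (B : ℕ) :
    ∃ V : Subgroup (decomp (K := ℚ) v), IsOpen (V : Set (decomp (K := ℚ) v)) ∧
      ∀ x ∈ V, (p : ℤ_[p]) ^ B ∣ (κ (x : absoluteGaloisGroup ℚ)).toAdd :=
  ⟨(κ.layerSubgroup B).subgroupOf (decomp v), (κ.isOpen_layerSubgroup B).preimage continuous_subtype_val,
    fun _ hx ↦ ZpExtension.mem_layerSubgroup.1 ((Subgroup.mem_subgroupOf).1 hx)⟩

end Layers

/-! ## §3. The unramified quotient `D = E[p^∞]/C_p` of Greenberg's datum: `I_p` acts trivially,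
continuity, finiteness of Frobenius-fixed points and of `p^k`-torsion, divisibility,
and SURJECTIVITY of `Frob − 1` -/

section Quotient

variable (W : WeierstrassCurve ℚ) [W.IsGloballyMinimal] [W.IsElliptic] (p : ℕ) [hp : Fact p.Prime]
  {v : HeightOneSpectrum (𝓞 ℚ)} (hpv : ((p : ℕ) : 𝓞 ℚ) ∈ v.asIdeal)
  (hΔ : ¬ (p : ℤ) ∣ W.minimalDiscriminantInt)

omit [W.IsElliptic] in
/-- Continuity of the orbit maps of `D_v` on `D = E[p^∞]/C_v` (discrete). [cite: GreenbergVatsal2000, §2 p. 26 with GreenbergLNM1716, §2 Prop. 2.4 (the unramified quotient E[p^∞]/C at p: topology of the decomposition group, Frobenius layers, divisibility)] -/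
theorem continuous_smul_gr (d : (reductionDatum W p hpv hΔ).Gr) :
    Continuous fun g : decomp (K := ℚ) v ↦ g • d := by
  obtain ⟨m, rfl⟩ := (reductionDatum W p hpv hΔ).grMk_surjective d
  have e : (fun g : decomp (K := ℚ) v ↦ g • (reductionDatum W p hpv hΔ).grMk m) =
      fun g : decomp (K := ℚ) v ↦
        (reductionDatum W p hpv hΔ).grMk (((g : decomp (K := ℚ) v) : absoluteGaloisGroup ℚ) • m) :=
    funext fun g ↦ LocalDatum.smul_grMk _ g m
  rw [e]
  exact continuous_of_discreteTopology.comp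
    ((W.continuous_smul_geomPrimaryTorsion p m).comp continuous_subtype_val)

/-- Equality of classes in `M ⧸ M⁺_v`: `grMk a = grMk b ↔ a - b ∈ M⁺_v`. [cite: GreenbergVatsal2000, §2 p. 26 with GreenbergLNM1716, §2 Prop. 2.4 (the unramified quotient E[p^∞]/C at p: topology of the decomposition group, Frobenius layers, divisibility)] -/
theorem grMk_eq_grMk_iff {K : Type u} [Field K] [NumberField K] {M : Type u} [AddCommGroup M]
    [DistribMulAction (absoluteGaloisGroup K) M] {v : HeightOneSpectrum (𝓞 K)}
    (N : LocalDatum K M v) (a b : M) : N.grMk a = N.grMk b ↔ a - b ∈ N.plus := by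
  rw [← sub_eq_zero, ← map_sub, ← AddMonoidHom.mem_ker, LocalDatum.ker_grMk]

omit [W.IsElliptic] in
/-- **`I_v` acts trivially on `D = E[p^∞]/C_v`** (GV's "`I_p` acts trivially on `D`"
`reductionDatum_htriv`). [cite: GreenbergVatsal2000, §2 p. 26] -/
theorem smul_gr_eq_of_mem_inertia {i : decomp (K := ℚ) v} (hi : (i : absoluteGaloisGroup ℚ) ∈ inertia v)
    (d : (reductionDatum W p hpv hΔ).Gr) : i • d = d := by
  obtain ⟨m, rfl⟩ := (reductionDatum W p hpv hΔ).grMk_surjective d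
  rw [LocalDatum.smul_grMk, grMk_eq_grMk_iff]
  exact reductionDatum_htriv W p hpv hΔ _ hi m

omit [W.IsElliptic] in
/-- Two elements of `E[p^∞]` with the same reduction have the same class in `D = E[p^∞]/C_v`.
[cite: GreenbergVatsal2000, §2 p. 26 with GreenbergLNM1716, §2 Prop. 2.4 (the unramified quotient E[p^∞]/C at p: topology of the decomposition group, Frobenius layers, divisibility)] -/
theorem grMk_eq_grMk_of_localRed_eq {m m' : W.geomPrimaryTorsion p}
    (h : localRed W p hpv hΔ (pointsMap W (v.adicCompletion ℚ) (m : W.geomPoints)) =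
      localRed W p hpv hΔ (pointsMap W (v.adicCompletion ℚ) (m' : W.geomPoints))) :
    (reductionDatum W p hpv hΔ).grMk m = (reductionDatum W p hpv hΔ).grMk m' := by
  rw [grMk_eq_grMk_iff, mem_reductionDatum_plus_iff, AddSubgroupClass.coe_sub, map_sub, map_sub, h,
    sub_self]

omit [W.IsElliptic] in
/-- The class of `m` in `D` is fixed by `δ ∈ D_v` iff `red_v` of `δ • m` and of `m` agree. [cite: GreenbergVatsal2000, §2 p. 26 with GreenbergLNM1716, §2 Prop. 2.4 (the unramified quotient E[p^∞]/C at p: topology of the decomposition group, Frobenius layers, divisibility)] -/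
theorem smul_grMk_eq_iff (δ : decomp (K := ℚ) v) (m : W.geomPrimaryTorsion p) :
    δ • (reductionDatum W p hpv hΔ).grMk m = (reductionDatum W p hpv hΔ).grMk m ↔
      localRed W p hpv hΔ (pointsMap W (v.adicCompletion ℚ)
          (((δ : absoluteGaloisGroup ℚ) • m : W.geomPrimaryTorsion p) : W.geomPoints)) =
        localRed W p hpv hΔ (pointsMap W (v.adicCompletion ℚ) (m : W.geomPoints)) := by
  rw [LocalDatum.smul_grMk]
  constructor
  · intro h
    rw [grMk_eq_grMk_iff, mem_reductionDatum_plus_iff, AddSubgroupClass.coe_sub, map_sub, map_sub,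
      sub_eq_zero] at h
    exact h
  · exact grMk_eq_grMk_of_localRed_eq W p hpv hΔ

omit [W.IsElliptic] in
/-- **The points of `D = E[p^∞]/C_v` fixed by a Frobenius form a finite set** ("`Ẽ(𝔽_p)[p^∞]` is
finite"): for `τ ∈ Γ_{ℚ_v}` an arithmetic Frobenius at a prime `𝔐` of `\bar 𝓞_v` (spectral valuation
`specVal v`), `{d : (res τ) • d = d}` is finite — it injects into the finite set of reductions fixed
by `τ` (`exists_finset_localRed_smul_frobenius`). [cite: GreenbergLNM1716, §2 p. 70] -/
theorem finite_fixed_frob {𝔐 : Ideal v.localAbsIntegers} (h𝔐 : 𝔐 ∈ v.localPrimesAbove)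
    {τ : absoluteGaloisGroup (v.adicCompletion ℚ)}
    (hτ : IsArithFrobAt (v.adicCompletionIntegers ℚ) τ 𝔐) :
    Set.Finite {d : (reductionDatum W p hpv hΔ).Gr |
      (⟨absGaloisRestrict ℚ (v.adicCompletion ℚ) τ, ⟨τ, rfl⟩⟩ : decomp (K := ℚ) v) • d = d} := by
  set N := reductionDatum W p hpv hΔ with hN
  obtain ⟨SF, hSF⟩ := W.exists_finset_localRed_smul_frobenius (specVal_spec v)
    (W.isUnit_Δ_localIntModel hpv (specVal_spec v) hΔ) (localRed W p hpv hΔ) (fun _ ↦ rfl) h𝔐 hτ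
  -- choose representatives
  choose rep hrep using N.grMk_surjective
  let θ : N.Gr → _ := fun d ↦ localRed W p hpv hΔ (pointsMap W (v.adicCompletion ℚ) (rep d : W.geomPoints))
  have hθinj : Function.Injective θ := fun d d' h ↦ by
    rw [← hrep d, ← hrep d']
    exact grMk_eq_grMk_of_localRed_eq W p hpv hΔ h
  refine Set.Finite.subset (Set.Finite.preimage hθinj.injOn (SF.finite_toSet)) fun d hd ↦ ?_
  rw [Set.mem_preimage, Finset.mem_coe]
  refine hSF _ ?_
  rw [Set.mem_setOf_eq, ← hrep d, smul_grMk_eq_iff, primaryComponent.coe_smul] at hd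
  have e : (((⟨absGaloisRestrict ℚ (v.adicCompletion ℚ) τ, ⟨τ, rfl⟩⟩ : decomp (K := ℚ) v) :
      absoluteGaloisGroup ℚ)) = absGaloisRestrict ℚ (v.adicCompletion ℚ) τ := rfl
  rw [e, pointsMap_absGaloisRestrict_smul] at hd
  exact hd

/-- **`D[p^k]` is finite** ("`Ẽ[p^k]` is finite"): the `p^k`-torsion of `D = E[p^∞]/C_v` injects
(via `red_v`) into `red_v(E(ℚ̄_v)[p^k])` (`localRed_ordinary_filtration`: `red_v` maps `E[p^k]` onto
`Ẽ[p^k]`; good ORDINARY `p`), a finite set (Silverman III.6.4). [cite: GreenbergLNM1716, §1 p. 62]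
[cite: SilvermanAEC2009, Cor. III.6.4] -/
theorem finite_torsionBy_gr (hord : ¬ (p : ℤ) ∣ W.frobeniusTrace p) (k : ℕ) :
    Set.Finite {d : (reductionDatum W p hpv hΔ).Gr | p ^ k • d = 0} := by
  set N := reductionDatum W p hpv hΔ with hN
  -- residue characteristic `p` (as in `GreenbergVatsalReductionDatumLine`)
  have hΔu := W.isUnit_Δ_localIntModel hpv (specVal_spec v) hΔ
  have hvO : (specVal v).Integers (specVal v).valuationSubring :=
    Valuation.valuationSubring.integers (specVal v)
  have hpO : specVal v ((p : ℕ) : AlgebraicClosure (v.adicCompletion ℚ)) < 1 := by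
    have h := IsDedekindDomain.HeightOneSpectrum.spectralValuation_algebraMap_ringOfIntegers_lt_one (v := v)
      (specVal_spec v) hpv
    rwa [map_natCast] at h
  haveI hchar : CharP (IsLocalRing.ResidueField ↥(specVal v).valuationSubring) p := by
    refine (CharP.charP_iff_prime_eq_zero hp.out).mpr ?_
    rw [← map_natCast (IsLocalRing.residue ↥(specVal v).valuationSubring),
      IsLocalRing.residue_eq_zero_iff, IsLocalRing.mem_maximalIdeal, mem_nonunits_iff,
      hvO.isUnit_iff_valuation_eq_one]
    exact fun h ↦ absurd h (ne_of_lt (by simpa using hpO))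
  have hordA := W.exists_zsmul_eq_zero_localRed_ne_zero (specVal_spec v) hΔu (localRed W p hpv hΔ)
    (fun _ ↦ rfl) hpv hΔ hord
  obtain ⟨-, hsurjk, -⟩ := W.localRed_ordinary_filtration hΔu (localRed W p hpv hΔ) (fun _ ↦ rfl) hordA
  -- the finite set of reductions of `p^k`-torsion points
  have hn : ((p ^ k : ℕ) : ℤ) ≠ 0 := by exact_mod_cast pow_ne_zero k hp.out.ne_zero
  haveI : Finite (WeierstrassCurve.torsionPoints W (AlgebraicClosure (v.adicCompletion ℚ)) ((p ^ k : ℕ) : ℤ)) :=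
    W.finite_torsionPoints_holds (AlgebraicClosure (v.adicCompletion ℚ)) hn
  set T : Set (localPoints W (v.adicCompletion ℚ)) := {Q | ((p ^ k : ℕ) : ℤ) • Q = 0} with hT
  have hTfin : T.Finite := by
    haveI : Finite T := by
      refine Finite.of_injective (fun Q : T ↦
        (⟨(Q : localPoints W (v.adicCompletion ℚ)), (W.mem_torsionPoints_iff _ _).2 Q.2⟩ :
          W.torsionPoints (AlgebraicClosure (v.adicCompletion ℚ)) ((p ^ k : ℕ) : ℤ))) ?_
      intro a b hab
      exact Subtype.ext (congrArg Subtype.val hab)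
    exact Set.toFinite T
  choose rep hrep using N.grMk_surjective
  let θ : N.Gr → _ := fun d ↦ localRed W p hpv hΔ (pointsMap W (v.adicCompletion ℚ) (rep d : W.geomPoints))
  have hθinj : Function.Injective θ := fun d d' h ↦ by
    rw [← hrep d, ← hrep d']
    exact grMk_eq_grMk_of_localRed_eq W p hpv hΔ h
  refine Set.Finite.subset (Set.Finite.preimage hθinj.injOn ((hTfin.image (localRed W p hpv hΔ))))
    fun d hd ↦ ?_
  rw [Set.mem_setOf_eq, ← hrep d, ← map_nsmul, ← AddMonoidHom.mem_ker,
    LocalDatum.ker_grMk, mem_reductionDatum_plus_iff, AddSubmonoidClass.coe_nsmul, map_nsmul,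
    map_nsmul] at hd
  obtain ⟨x, hx, hxred⟩ := hsurjk k (θ d) (by rw [natCast_zsmul]; exact hd)
  exact ⟨x, hx, hxred⟩

/-- `D = E[p^∞]/C_v` is `p`-divisible and `p`-primary. [cite: SilvermanAEC2009, Prop. III.4.2(a)] -/
theorem divisible_and_primary_gr (d : (reductionDatum W p hpv hΔ).Gr) :
    (∃ d' : (reductionDatum W p hpv hΔ).Gr, p • d' = d) ∧ ∃ k : ℕ, p ^ k • d = 0 := by
  obtain ⟨m, rfl⟩ := (reductionDatum W p hpv hΔ).grMk_surjective d
  refine ⟨?_, ?_⟩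
  · obtain ⟨m', hm'⟩ := GreenbergVatsalTorsionCurve.divisible_curve W p m
    exact ⟨(reductionDatum W p hpv hΔ).grMk m', by rw [← map_nsmul, hm']⟩
  · obtain ⟨k, hk⟩ := (AddCommGroup.mem_primaryComponent).1 m.2
    refine ⟨k, ?_⟩
    rw [← map_nsmul]
    have : p ^ k • m = 0 := Subtype.ext (by rw [AddSubmonoidClass.coe_nsmul, ZeroMemClass.coe_zero]; exact hk)
    rw [this, map_zero]

/-- **`Frob − 1` is surjective on `D = E[p^∞]/C_v ≅ Ẽ[p^∞]`** (good ordinary `p`): an endomorphism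
with finite kernel (`finite_fixed_frob`) of a `p`-divisible `p`-primary group with finite
`p^k`-torsion (`finite_torsionBy_gr`) — `GreenbergVatsalStrictCore.surjective_of_finite_ker_of_divisible`.
Equivalently `H¹(Ẑ·Frob, Ẽ[p^∞]) = 0`. [cite: GreenbergLNM1716, §2 p. 73] -/
theorem exists_frob_smul_sub_eq (hord : ¬ (p : ℤ) ∣ W.frobeniusTrace p)
    {𝔐 : Ideal v.localAbsIntegers} (h𝔐 : 𝔐 ∈ v.localPrimesAbove)
    {τ : absoluteGaloisGroup (v.adicCompletion ℚ)}
    (hτ : IsArithFrobAt (v.adicCompletionIntegers ℚ) τ 𝔐) (d : (reductionDatum W p hpv hΔ).Gr) :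
    ∃ d' : (reductionDatum W p hpv hΔ).Gr,
      (⟨absGaloisRestrict ℚ (v.adicCompletion ℚ) τ, ⟨τ, rfl⟩⟩ : decomp (K := ℚ) v) • d' - d' = d := by
  set φ₀ : decomp (K := ℚ) v := ⟨absGaloisRestrict ℚ (v.adicCompletion ℚ) τ, ⟨τ, rfl⟩⟩ with hφ₀
  set f : (reductionDatum W p hpv hΔ).Gr →+ (reductionDatum W p hpv hΔ).Gr :=
    DistribSMul.toAddMonoidHom _ φ₀ - AddMonoidHom.id _ with hf
  have hf_apply : ∀ x, f x = φ₀ • x - x := fun x ↦ rfl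
  have hsurj := surjective_of_finite_ker_of_divisible (p := p) f
    (fun x ↦ (divisible_and_primary_gr W p hpv hΔ x).2)
    (fun x ↦ (divisible_and_primary_gr W p hpv hΔ x).1)
    (finite_torsionBy_gr W p hpv hΔ hord)
    (by
      have e : (f.ker : Set (reductionDatum W p hpv hΔ).Gr) = {x | φ₀ • x = x} := by
        ext x
        rw [SetLike.mem_coe, AddMonoidHom.mem_ker, hf_apply, sub_eq_zero, Set.mem_setOf_eq]
      rw [e]
      exact finite_fixed_frob W p hpv hΔ h𝔐 hτ)
  obtain ⟨d', hd'⟩ := hsurj d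
  exact ⟨d', by rw [← hf_apply, hd']⟩

end Quotient

end Literature.NumberTheory.EllipticCurves.Greenberg1999.GreenbergVatsalStrictAtPQuotient

end Part5

/-!
## Part 6 — port of `Summits/BirchSwinnertonDyer/Rank1Residual/X2/GreenbergVatsalStrictAtP.lean` (1 declarations kept)

# Greenberg classes are strict at the place above `p`: `greenbergKer ≤ strictKer` (Greenberg–Vatsal 2000, §2 p. 26)

Declarations of this Part (verbatim port; each keeps its own docstring and citation): `greenbergKer_le_strictKer`.

Reference keys (see `references.bib` and the declarations' citations): [GreenbergLNM1716], [GreenbergVatsal2000], [Greenberg1989].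
-/

section Part6

open scoped _root_.Classical _root_.NNReal

universe u

namespace Literature.NumberTheory.EllipticCurves.Greenberg1999.GreenbergVatsalStrictAtP

open _root_.NumberField _root_.IsDedekindDomain _root_.Field Literature.NumberTheory.GaloisRepresentations
  Literature.NumberTheory.EllipticCurves Literature.NumberTheory.EllipticCurves.GreenbergSelmer
  Literature.NumberTheory.EllipticCurves.ResKernel
  Literature.NumberTheory.EllipticCurves.RibetGoodLattice.GreenbergVatsalReductionDatum
  Literature.NumberTheory.EllipticCurves.Greenberg1999.GreenbergVatsalStrictCore

open Literature.NumberTheory.EllipticCurves.Greenberg1999.GreenbergVatsalStrictAtPQuotient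

/-! ## §4. Greenberg's condition ⇒ the strict condition at `p` over `ℚ_∞^{cyc}` -/

section Main

variable (W : WeierstrassCurve ℚ) [W.IsGloballyMinimal] [W.IsElliptic] (p : ℕ) [hp : Fact p.Prime]
  (κ : ZpExtension ℚ p) {v : HeightOneSpectrum (𝓞 ℚ)}

/-- **At the prime of `ℚ_∞` above a good ORDINARY `p`, Greenberg's INERTIA-form local condition
implies the STRICT (decomposition-group) condition, for Greenberg's datum `C_p = ker(E[p^∞] → Ẽ)`:
`greenbergKer ≤ strictKer`** (the converse `strictKer ≤ greenbergKer` is the tree's tautology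
`LocalDatum.strictKer_le_greenbergKer`). Over the cyclotomic tower the decomposition group of
`ℚ_{∞,𝔭}` contains a Frobenius (`ZpExtension.IsCyclotomic.exists_isArithFrobAt_resGal_mem_kerSubgroup`:
`ℚ_∞/ℚ` is totally ramified at `p`), is generated by it and inertia
(`exists_eq_frob_pow_mul_of_decomp`), inertia fills every layer (`exists_layer_le_kappa_inertia`),
and `Frob − 1` is surjective on the unramified quotient `D = Ẽ[p^∞]` (`exists_frob_smul_sub_eq`);
so a class dying in `H¹(H ⊓ I_p, D)` dies in `H¹(H ⊓ D_p, D)`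
(`GreenbergVatsalStrictCore.exists_eq_smul_sub_of_vanishing_on_inertia_of_surjective`). This is the
step between GV's `L_𝔭 = ker(H¹((ℚ_∞)_𝔭, A) → H¹(I_𝔭, D))` (p. 16) and Greenberg's
`Im λ = ker(H¹(K, E[p^∞]) → H¹(K, Ẽ[p^∞]))` (LNM 1716 Prop. 2.2, p. 74), now a kernel theorem.
[cite: GreenbergLNM1716, §2 pp. 73–74] [cite: GreenbergVatsal2000, §2 pp. 16, 26] -/
theorem greenbergKer_le_strictKer (hκ : κ.IsCyclotomic) (hpv : ((p : ℕ) : 𝓞 ℚ) ∈ v.asIdeal)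
    (hΔ : ¬ (p : ℤ) ∣ W.minimalDiscriminantInt) (hord : ¬ (p : ℤ) ∣ W.frobeniusTrace p) :
    (reductionDatum W p hpv hΔ).greenbergKer κ.kerSubgroup ≤
      (reductionDatum W p hpv hΔ).strictKer κ.kerSubgroup := by
  intro c hc
  obtain ⟨f, rfl⟩ :=
    oneCocycleClass_surjective (discreteTopRep κ.kerSubgroup (W.geomPrimaryTorsion p)) c
  obtain ⟨q, hq⟩ := (GreenbergVatsalSelmerLink.oneCocycleClass_mem_greenbergKer_iff κ.kerSubgroup _
    (reductionDatum W p hpv hΔ) f).1 hc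
  rw [LocalDatum.mem_strictKer_iff, LocalDatum.strictMap, resH1Hom_oneCocycleClass,
    oneCocycleClass_eq_zero_iff]
  -- the local Frobenius inside `H`
  obtain ⟨𝔐, h𝔐⟩ := v.localPrimesAbove_nonempty
  have hϖ := IsDedekindDomain.HeightOneSpectrum.irreducible_natCast_adicCompletionIntegers_rat hpv
  obtain ⟨τ, hτ, hτH⟩ := hκ.exists_isArithFrobAt_resGal_mem_kerSubgroup (specVal_spec v) h𝔐 hpv hϖ
  set φ₀ : decomp (K := ℚ) v := ⟨absGaloisRestrict ℚ (v.adicCompletion ℚ) τ, ⟨τ, rfl⟩⟩ with hφ₀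
  have hφ₀P : φ₀ ∈ decompIn κ.kerSubgroup v := by
    rw [mem_decompIn_iff]
    change absGaloisRestrict ℚ (v.adicCompletion ℚ) τ ∈ κ.kerSubgroup
    rw [← WeierstrassCurve.resGal_eq_absGaloisRestrict]; exact hτH
  -- dictionaries
  have hDeq : decomp v = (adicCompletionPrime ℚ v).decompositionSubgroup (absoluteGaloisGroup ℚ) :=
    (decompositionSubgroup_adicCompletionPrime_eq_range ℚ v).symm
  have hIeq : inertia v = (adicCompletionPrime ℚ v).inertia (absoluteGaloisGroup ℚ) :=
    (inertia_adicCompletionPrime_eq_map_absInertia ℚ v).symm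
  haveI := compactSpace_decomp (K := ℚ) v
  obtain ⟨b, hb⟩ := exists_eq_smul_sub_of_vanishing_on_inertia_of_surjective
    (G := decomp (K := ℚ) v) (D := (reductionDatum W p hpv hΔ).Gr) (p := p)
    (I := (inertia v).subgroupOf (decomp v)) (P := decompIn κ.kerSubgroup v)
    (fun g i hi ↦ by
      rw [Subgroup.mem_subgroupOf] at hi ⊢
      simp only [Subgroup.coe_mul, Subgroup.coe_inv]
      rw [hIeq] at hi ⊢
      exact GreenbergVatsalUnramifiedAway.conj_mem_inertia_of_mem_decompositionSubgroup _
        (hDeq ▸ g.2) hi)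
    hφ₀P
    (fun U hU d ↦ by
      obtain ⟨n, i, u, hi, hu, hd⟩ := exists_eq_frob_pow_mul_of_decomp v (specVal_spec v) h𝔐 hτ U hU d
      exact ⟨n, i, u, (Subgroup.mem_subgroupOf).2 hi, hu, hd⟩)
    (κ.toContinuousMonoidHom.toMonoidHom.comp (decomp v).subtype)
    (fun {x} ↦ by
      rw [mem_decompIn_iff, ZpExtension.mem_kerSubgroup]; rfl)
    (fun U hUn hU ↦ by
      haveI := hUn
      obtain ⟨B, hB⟩ := exists_layer_le_kappa_inertia κ v hκ hpv U hU
      refine ⟨B, fun u hu ↦ ?_⟩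
      obtain ⟨w, hwU, hwI, hκw⟩ := hB u hu
      exact ⟨w, hwU, (Subgroup.mem_subgroupOf).2 hwI, hκw⟩)
    (fun B ↦ exists_open_layer κ v B)
    (continuous_smul_gr W p hpv hΔ)
    (fun i hi d ↦ smul_gr_eq_of_mem_inertia W p hpv hΔ ((Subgroup.mem_subgroupOf).1 hi) d)
    (exists_frob_smul_sub_eq W p hpv hΔ hord h𝔐 hτ)
    (contOneCocycles.pullback (decompInToH κ.kerSubgroup v)
      (resHomOfEquivariant _ (reductionDatum W p hpv hΔ).grMk fun _ _ ↦ rfl) f)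
    (fun x hxI ↦ by
      rw [contOneCocycles.pullback_apply]
      have hxH : ((x : decomp (K := ℚ) v) : absoluteGaloisGroup ℚ) ∈ κ.kerSubgroup :=
        (mem_decompIn_iff κ.kerSubgroup v _).1 x.2
      set x' : inertiaIn κ.kerSubgroup v := ⟨(x : decomp (K := ℚ) v),
        (mem_inertiaIn_iff κ.kerSubgroup v _).2 ⟨hxH, (Subgroup.mem_subgroupOf).1 hxI⟩⟩ with hx'
      have h := hq x'
      have e1 : inertiaInToH κ.kerSubgroup v x' = decompInToH κ.kerSubgroup v x := Subtype.ext rfl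
      have e2 : x' • q - q = 0 := by
        rw [sub_eq_zero, Subgroup.smul_def]
        exact smul_gr_eq_of_mem_inertia W p hpv hΔ ((Subgroup.mem_subgroupOf).1 hxI) q
      rw [e1, e2] at h
      exact h)
  exact ⟨b, fun x ↦ hb x⟩

end Main

end Literature.NumberTheory.EllipticCurves.Greenberg1999.GreenbergVatsalStrictAtP

end Part6

/-!
## Part 7 — port of `Summits/BirchSwinnertonDyer/Rank1Residual/Additive/GoodModelKummerOfCoatesGreenberg.lean` (3 declarations kept)

# Greenberg LNM 1716 Prop. 2.4 (Kummer = strict at a good ordinary place) from Coates–Greenberg 1996 (H¹(K, Ê) = 0 over a deeply ramified field)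

Declarations of this Part (verbatim port; each keeps its own docstring and citation): `oneCocycleClass_mem_strictKer_iff`, `imKummer_ge_strictCondition_goodOrdinaryModel_of_coatesGreenberg`, `imKummer_ge_strictCondition_goodOrdinary_of_coatesGreenberg`.

Reference keys (see `references.bib` and the declarations' citations): [CoatesGreenberg1996], [LeeCY2013], [GreenbergLNM1716], [Greenberg1989].
-/

section Part7

open scoped _root_.Classical _root_.NNReal

open _root_.WeierstrassCurve

universe u

namespace Literature.NumberTheory.EllipticCurves.CoatesGreenberg1996.GoodModelLine

open _root_.NumberField _root_.IsDedekindDomain _root_.Field _root_.IsDedekindDomain.HeightOneSpectrum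
  Literature.NumberTheory.GaloisRepresentations Literature.NumberTheory.EllipticCurves
  Literature.NumberTheory.EllipticCurves.GreenbergSelmer
  Literature.NumberTheory.EllipticCurves.CoatesGreenberg1996
  Literature.NumberTheory.EllipticCurves.Greenberg1999.GreenbergVatsalSelmerLink

/-! ## §1 Cocycle criterion for the strict condition -/

section Strict

variable {K : Type u} [Field K] [NumberField K] (H : Subgroup (absoluteGaloisGroup K))
  (M : Type u) [AddCommGroup M] [DistribMulAction (absoluteGaloisGroup K) M]
  [TopologicalSpace M] [DiscreteTopology M]

/-- **Cocycle criterion for the STRICT condition at `v ∣ p`**: the class of `f` lies in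
`N.strictKer H` iff `f mod M⁺_v` is principal on `H ⊓ D_v` with values in `M/M⁺_v`.
[cite: Greenberg1989, §1 p. 98] -/
theorem oneCocycleClass_mem_strictKer_iff {v : HeightOneSpectrum (𝓞 K)} (N : LocalDatum K M v)
    (f : contOneCocycles (discreteTopRep H M)) :
    oneCocycleClass (discreteTopRep H M) f ∈ N.strictKer H ↔
      ∃ q : N.Gr, ∀ x : decompIn H v, N.grMk (f.1 (decompInToH H v x)) = x • q - q := by
  rw [LocalDatum.mem_strictKer_iff, LocalDatum.strictMap, resH1Hom_oneCocycleClass,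
    oneCocycleClass_eq_zero_iff]
  rfl

end Strict

/-! ## §2 S2 from the Coates–Greenberg record -/

section Main

/-- **S2 DERIVED from the Coates–Greenberg good-model record: Greenberg's Prop. 2.4 (`Im λ_K ⊆ Im κ_K`)
for a GOOD ORDINARY MODEL `W₀ = C • E ⊗ K̄_v` at every layer `H ≤ ker κ` whose local group fixes `C`**
(`Greenberg1999.imKummer_ge_strictCondition_goodOrdinaryModel`, cc-typer-2 p285955), from
`H¹(L, Ŵ₀(𝔪̄)) = 0` (`hCG`): a strict class restricted to `H_v` is, modulo the coboundary of a lift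
`ι m` of the principalising class, a cocycle with values in `ι(C_v) ⊆ Φ_C⁻¹(Ŵ₀(𝔪̄))`, hence the
coboundary of some `a`, so the class is `∂(a + ι m)` in `H¹(H_v, E(K̄_v))`: the Kummer condition.
The binders `hord`, `hHi` of S2 are not used — in print: "for any deeply ramified extension
`𝔉/F`, we have `Im(κ_𝔉) = Im(λ_𝔉)`" (C.-Y. Lee 2013 Thm. 2.4.2 = [CoGr] Prop. 4.3, no reduction-type
hypothesis). [cite: GreenbergLNM1716, §2 Prop. 2.4 (pp. 74–75) and p. 83]
[cite: CoatesGreenberg1996, Cor. 3.2 and Prop. 4.3 (through GreenbergLNM1716, Coates p. 37 (74))]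
[cite: LeeCY2013, Thm. 2.4.2 (thesis version p. 43)] -/
theorem imKummer_ge_strictCondition_goodOrdinaryModel_of_coatesGreenberg
    (hCG : H1_goodModelKernel_trivial.{0}) :
    Greenberg1999.imKummer_ge_strictCondition_goodOrdinaryModel := by
  intro W _ p _ κ hκ v hpv w hw C W₀ hW₀ hΔ red hred _hord N hN H hHc hHκ _hHi hHC c hc
  obtain ⟨f, rfl⟩ := oneCocycleClass_surjective (discreteTopRep H (W.geomPrimaryTorsion p)) c
  obtain ⟨q, hq⟩ := (oneCocycleClass_mem_strictKer_iff H _ N f).1 hc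
  obtain ⟨m, rfl⟩ := N.grMk_surjective q
  -- notation
  set E := v.adicCompletion ℚ with hE
  set G : Subgroup (absoluteGaloisGroup E) := localSubgroup H E with hG
  set ι : W.geomPoints →+ localPoints W E := pointsMap W E with hι
  -- the pulled-back cocycle `F τ = ι (f (res τ))` on `G = H_v`
  set F : contOneCocycles (discreteTopRep G (localPoints W E)) :=
    contOneCocycles.pullback (resGalSubgroup H E)
      (resHomOfEquivariant (resGalSubgroup H E)
        ((pointsMap W E).comp (W.geomPrimaryTorsion p).subtype) fun τ P ↦ by
          simp only [AddMonoidHom.coe_comp, AddSubgroup.coe_subtype, Function.comp_apply,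
            Subgroup.smul_def, resGalSubgroup_apply_coe,
            Literature.NumberTheory.EllipticCurves.primaryComponent.coe_smul]
          exact pointsMap_smul W E τ P) f with hF
  have hFapply : ∀ τ : G, F.1 τ = ι ((f.1 (resGalSubgroup H E τ) : W.geomPrimaryTorsion p) :
      W.geomPoints) := fun τ ↦ rfl
  -- the coboundary of `ι m`
  have hcont : Continuous fun τ : G ↦ τ • ι (m : W.geomPoints) := by
    have hc : Continuous ((fun σ : absoluteGaloisGroup E ↦ σ • ι (m : W.geomPoints)) ∘
        (Subtype.val : G → absoluteGaloisGroup E)) :=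
      (continuous_smul_localPoints W E (ι (m : W.geomPoints))).comp continuous_subtype_val
    exact hc
  set ψ : contOneCocycles (discreteTopRep G (localPoints W E)) :=
    F - coboundaryCocycle (ι (m : W.geomPoints)) hcont with hψ
  -- each `τ ∈ H_v` gives an element of `H ⊓ D_v`
  have hyτ : ∀ τ : G, ∃ y : decompIn H v,
      decompInToH H v y = resGalSubgroup H E τ ∧
        ((y : decomp (K := ℚ) v) : absoluteGaloisGroup ℚ) = absGaloisRestrict ℚ E τ := by
    intro τ
    have hτH : absGaloisRestrict ℚ E τ ∈ H := (mem_localSubgroup_iff H E τ.1).1 τ.2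
    refine ⟨⟨⟨absGaloisRestrict ℚ E τ, (mem_decomp_iff v _).2 ⟨τ, rfl⟩⟩,
      (mem_decompIn_iff H v _).2 hτH⟩, Subtype.ext rfl, rfl⟩
  -- `ψ τ = ι (f (res τ) - (res τ • m - m))` and the bracket lies in `N.plus`
  have hψval : ∀ τ : G, ∃ n : W.geomPrimaryTorsion p, n ∈ N.plus ∧
      ψ.1 τ = ι (n : W.geomPoints) := by
    intro τ
    obtain ⟨y, hy, hy'⟩ := hyτ τ
    refine ⟨f.1 (resGalSubgroup H E τ) - (absGaloisRestrict ℚ E τ • m - m), ?_, ?_⟩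
    · have hym : y • N.grMk m = N.grMk (absGaloisRestrict ℚ E τ • m) := by
        rw [← hy']; rfl
      rw [← N.ker_grMk, AddMonoidHom.mem_ker, map_sub, map_sub, ← hy, hq y, hym]
      exact sub_self _
    · rw [hψ, cocycle_sub_apply, coboundaryCocycle_apply, hFapply]
      simp only [AddSubgroupClass.coe_sub, map_sub,
        Literature.NumberTheory.EllipticCurves.primaryComponent.coe_smul]
      have hsm : pointsMap W E (absGaloisRestrict ℚ E (τ : absoluteGaloisGroup E) •
            (m : W.geomPoints)) = τ • pointsMap W E (m : W.geomPoints) :=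
        pointsMap_smul W E (τ : absoluteGaloisGroup E) (m : W.geomPoints)
      rw [hsm]
  -- hence `ψ` has values in the kernel of reduction of the good model
  have hkernel : ∀ τ : G, Affine.Point.congrEquiv hW₀ (VariableChange.pointEquiv _ C
      (Affine.Point.congrEquiv (baseChange_baseChange_adicCompletion W v).symm (ψ.1 τ))) ∈
        kernelOfReduction W₀ (Valuation.integer.integers w) := by
    intro τ
    obtain ⟨n, hn, hψn⟩ := hψval τ
    rw [hψn, mem_kernelOfReduction_iff,
      ← goodReductionHom_eq_zero_iff (Valuation.integer.integers w) hΔ, ← hred]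
    exact (hN n).1 hn
  -- the local group `G = H_v`: closed, below `(ker κ)_v`, fixing `C`
  have hGc : IsClosed (G : Set (absoluteGaloisGroup E)) :=
    hHc.preimage (map_continuous (resGal (K := ℚ) E))
  have hGκ : G ≤ localSubgroup κ.kerSubgroup E := fun τ hτ ↦
    (mem_localSubgroup_iff _ E τ).2 (hHκ ((mem_localSubgroup_iff H E τ).1 hτ))
  have hGC : ∀ σ ∈ G,
      C.map ((absoluteGaloisGroup.toAlgEquiv E σ :
          AlgebraicClosure E ≃ₐ[E] AlgebraicClosure E) :
          AlgebraicClosure E →+* AlgebraicClosure E) = C := fun σ hσ ↦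
    hHC σ ((mem_localSubgroup_iff H E σ).1 hσ)
  -- Coates–Greenberg: `ψ` is the coboundary of some `a` in the kernel of reduction
  obtain ⟨a, -, hφa⟩ := hCG ℚ W p κ hκ v hpv w hw C W₀ hW₀ hΔ G hGc hGκ hGC ψ hkernel
  -- so `F = ∂(a + ι m)`: the Kummer condition
  refine (oneCocycleClass_mem_localKerOver_iff W p H E f).2 ⟨a + ι (m : W.geomPoints), fun τ ↦ ?_⟩
  have h := hφa τ
  rw [hψ, cocycle_sub_apply, coboundaryCocycle_apply, hFapply, sub_eq_iff_eq_add] at h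
  change ι _ = _
  rw [h, Subgroup.smul_def, Subgroup.smul_def, smul_add]
  abel

/-- **A239 DERIVED from the Coates–Greenberg record** (through S2: `imKummer_ge_strictCondition_goodOrdinary_of_goodOrdinaryModel`): Greenberg's Prop. 2.4 for `E/ℚ`
good ordinary at `p`, the `hGrK` binder of the defect-2 R-D identifications (F8, p07's
`MixedCongruentPairGV`, F2/F7). [cite: GreenbergLNM1716, §2 Prop. 2.4 (pp. 74–75) and p. 83]
[cite: CoatesGreenberg1996, Cor. 3.2 (through GreenbergLNM1716)] -/
theorem imKummer_ge_strictCondition_goodOrdinary_of_coatesGreenberg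
    (hCG : H1_goodModelKernel_trivial.{0}) :
    Greenberg1999.imKummer_ge_strictCondition_goodOrdinary :=
  Greenberg1999.imKummer_ge_strictCondition_goodOrdinary_of_goodOrdinaryModel
    (imKummer_ge_strictCondition_goodOrdinaryModel_of_coatesGreenberg hCG)

end Main

/-! ## §3 Class forms: the δ-input on X4♯(G-ord) / X3♯(G-ord) mod the Coates–Greenberg record -/

section ClassForms

open Literature.NumberTheory.EllipticCurves.Rank1Residual
  Literature.NumberTheory.EllipticCurves.Rank1Residual.Typed

variable (W : WeierstrassCurve ℚ) [W.IsElliptic] [W.IsGloballyMinimal] (p : ℕ) [hp : Fact p.Prime]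

end ClassForms

end Literature.NumberTheory.EllipticCurves.CoatesGreenberg1996.GoodModelLine

end Part7

/-!
## Part 8 — port of `Summits/BirchSwinnertonDyer/BirchSwinnertonDyer/Theorems/PublishedInputsGreenbergKummerImageHolds.lean` (2 declarations kept)

# Greenberg LNM 1716 §2 Prop. 2.4 HOLDS: `imKummer_ge_strictCondition_goodOrdinaryModel_holds` and `imKummer_ge_strictCondition_goodOrdinary_holds` (EXACT names)

Declarations of this Part (verbatim port; each keeps its own docstring and citation): `imKummer_ge_strictCondition_goodOrdinaryModel_holds`, `imKummer_ge_strictCondition_goodOrdinary_holds`.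

Reference keys (see `references.bib` and the declarations' citations): [GreenbergLNM1716], [CoatesGreenberg1996], [Tate1967], [GreenbergVatsal2000].
-/

section Part8

set_option autoImplicit false

namespace Literature.NumberTheory.EllipticCurves.Greenberg1999

open Literature.NumberTheory.EllipticCurves Literature.NumberTheory.EllipticCurves.Greenberg1999
  Literature.NumberTheory.EllipticCurves.CoatesGreenberg1996

/-- **Greenberg LNM 1716 Prop. 2.4 for a good ordinary MODEL `W₀ = C • E ⊗ K̄_v` HOLDS** (
`Greenberg1999.imKummer_ge_strictCondition_goodOrdinaryModel`): the Coates–Greenberg derivation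
`GoodModelLine.imKummer_ge_strictCondition_goodOrdinaryModel_of_coatesGreenberg` fed the proved record
`H1_goodModelKernel_trivial_holds`. [cite: GreenbergLNM1716, §2 Prop. 2.4 (pp. 74–75) and p. 83]
[cite: CoatesGreenberg1996, Cor. 3.2 and Prop. 4.3] -/
theorem imKummer_ge_strictCondition_goodOrdinaryModel_holds : imKummer_ge_strictCondition_goodOrdinaryModel :=
  GoodModelLine.imKummer_ge_strictCondition_goodOrdinaryModel_of_coatesGreenberg CoatesGreenberg1996.H1_goodModelKernel_trivial_holds

/-- **Greenberg LNM 1716 Prop. 2.4 for `E/ℚ` good ordinary at `p` HOLDS** (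
`Greenberg1999.imKummer_ge_strictCondition_goodOrdinary`: over every layer `H ≤ ker κ` of finite index of the cyclotomic
tower, strict Greenberg classes at the place above `p` are Kummer) — EXACT-name discharge (in-tree original
`Summit.BirchSwinnertonDyer.BirchSwinnertonDyer.Theorems.InputsGreenbergKummerImage.imKummer_ge_strictCondition_goodOrdinary_holds`). [cite: GreenbergLNM1716, §2 Prop. 2.4 (pp. 74–75) and p. 83] [cite: CoatesGreenberg1996, Cor. 3.2 and Prop. 4.3] -/
theorem imKummer_ge_strictCondition_goodOrdinary_holds : imKummer_ge_strictCondition_goodOrdinary :=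
  GoodModelLine.imKummer_ge_strictCondition_goodOrdinary_of_coatesGreenberg CoatesGreenberg1996.H1_goodModelKernel_trivial_holds

end Literature.NumberTheory.EllipticCurves.Greenberg1999

end Part8

/-!
## Part 9 — port of `Summits/BirchSwinnertonDyer/Rank1Residual/GaloisImage/GreenbergConditionOfStrictCondition.lean` (4 declarations kept)

# From the strict condition to the Greenberg–Vatsal inertia condition at `p` (the fact's data are the tree's chosen reduction datum)

Declarations of this Part (verbatim port; each keeps its own docstring and citation): `valuation_eq_specVal`, `eq_localRed`, `eq_reductionDatum`, `imKummer_ge_greenbergCondition_at_p_of_strict`.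

Reference keys (see `references.bib` and the declarations' citations): [GreenbergLNM1716], [GreenbergVatsal2000], [NeukirchANT1999], [SilvermanAEC2009].
-/

section Part9

set_option autoImplicit false

open scoped _root_.Classical _root_.NNReal

universe u

namespace Literature.NumberTheory.EllipticCurves.GreenbergVatsal2000.GreenbergConditionOfStrictCondition

open _root_.NumberField _root_.IsDedekindDomain _root_.Field Literature.NumberTheory.GaloisRepresentations
  Literature.NumberTheory.EllipticCurves Literature.NumberTheory.EllipticCurves.GreenbergSelmer
  Literature.NumberTheory.EllipticCurves.Greenberg1999
  Literature.NumberTheory.EllipticCurves.GreenbergVatsal2000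
  Literature.NumberTheory.EllipticCurves.RibetGoodLattice.GreenbergVatsalReductionDatum
  Literature.NumberTheory.EllipticCurves.Greenberg1999.GreenbergVatsalStrictAtP
open _root_.WeierstrassCurve (minimalDiscriminantInt integralModelInt)

/-! ## §1. The fact's data ARE the tree's chosen datum -/

section Datum

/-- **Uniqueness of the spectral valuation**: an `ℝ≥0`-valued valuation on `K̄_v` whose real values
are the spectral norm IS the tree's chosen `specVal v` (both compute `spectralNorm`; `ℝ≥0 → ℝ` is
injective). [cite: NeukirchANT1999, Ch. II Thm. (4.8)] -/
theorem valuation_eq_specVal {K : Type u} [Field K] [NumberField K] (v : HeightOneSpectrum (𝓞 K))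
    (w : Valuation (AlgebraicClosure (v.adicCompletion K)) ℝ≥0)
    (hw : ∀ x, (w x : ℝ) =
      spectralNorm (v.adicCompletion K) (AlgebraicClosure (v.adicCompletion K)) x) :
    w = specVal v :=
  Valuation.ext fun x ↦ NNReal.coe_injective ((hw x).trans (specVal_spec v x).symm)

variable (W : WeierstrassCurve ℚ) [W.IsGloballyMinimal] [W.IsElliptic] (p : ℕ) [hp : Fact p.Prime]
  {v : HeightOneSpectrum (𝓞 ℚ)}

omit [W.IsElliptic] in
/-- **Any reduction map of the fact's shape over `𝒪_{specVal v}` is the tree's `localRed`** (both are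
the `reducePoint` of the point transported to the minimal integral model; `localRed_apply`).
[cite: SilvermanAEC2009, Prop. VII.2.1] -/
theorem eq_localRed (hpv : ((p : ℕ) : 𝓞 ℚ) ∈ v.asIdeal) (hΔ : ¬ (p : ℤ) ∣ minimalDiscriminantInt W)
    (red₀ : localPoints W (v.adicCompletion ℚ) →+
      (((integralModelInt W).map (algebraMap ℤ ↥(specVal v).valuationSubring)).map
        (IsLocalRing.residue ↥(specVal v).valuationSubring)).toAffine.Point)
    (hred₀ : ∀ P : localPoints W (v.adicCompletion ℚ), red₀ P =
      ((integralModelInt W).map (algebraMap ℤ ↥(specVal v).valuationSubring)).reducePoint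
        (WeierstrassCurve.Affine.Point.congrEquiv
          (W.localIntModel_baseChange (specVal v).valuationSubring).symm P)) :
    red₀ = localRed W p hpv hΔ :=
  AddMonoidHom.ext fun P ↦ (hred₀ P).trans (localRed_apply W p hpv hΔ P).symm

omit [W.IsElliptic] in
/-- **Any Greenberg datum of the fact's shape is the tree's `reductionDatum`**: if
`m ∈ N.plus ↔ red_v (ι m) = 0` then `N = reductionDatum W p hpv hΔ`
(`mem_reductionDatum_plus_iff`; a `LocalDatum` is determined by its `plus`). [cite: GreenbergLNM1716, §2 p. 70] -/
theorem eq_reductionDatum (hpv : ((p : ℕ) : 𝓞 ℚ) ∈ v.asIdeal)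
    (hΔ : ¬ (p : ℤ) ∣ minimalDiscriminantInt W) (N : LocalDatum ℚ (W.geomPrimaryTorsion p) v)
    (hN : ∀ m : W.geomPrimaryTorsion p,
      m ∈ N.plus ↔ localRed W p hpv hΔ (pointsMap W (v.adicCompletion ℚ) (m : W.geomPoints)) = 0) :
    N = reductionDatum W p hpv hΔ := by
  -- a `LocalDatum` is determined by its `plus` (tree: `LocalDatum.eq_of_plus_eq`,
  -- `Additive/RamifiedLineKummerEqBridge`; inlined here to keep this file's imports local)
  obtain ⟨plus, hplus⟩ := N
  have h : plus = (reductionDatum W p hpv hΔ).plus :=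
    AddSubgroup.ext fun m ↦ (hN m).trans (mem_reductionDatum_plus_iff W p hpv hΔ m).symm
  subst h
  rfl

end Datum

/-! ## §2. The composition: A239 ⟹ A111 -/

section Composition

/-- **A111 ⇐ A239.** Greenberg 1999 Prop. 2.4 in the strict form at every finite layer above `ℚ_∞`
(`Greenberg1999.imKummer_ge_strictCondition_goodOrdinary`, A239) IMPLIES Greenberg–Vatsal's
`L_𝔭 ⊆ im κ_𝔭` over `ℚ_∞` in the inertia form
(`GreenbergVatsal2000.imKummer_ge_greenbergCondition_at_p`, A111): at the layer `H = ker κ` the fact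
gives `strictKer ≤ localKerOver` (`.kerSubgroup`), and `greenbergKer ≤ strictKer` there is the X2
lineage's kernel theorem `GreenbergVatsalStrictAtP.greenbergKer_le_strictKer` (the cyclotomic tower is
totally ramified at `p`, so inertia fills the decomposition group up to a Frobenius, and `Frob − 1` is
onto on `Ẽ[p^∞]`), transported from the tree's chosen datum to the fact's data by §1. Hence the two
registry records are ONE independent hypothesis (A111 DERIVED modulo A239); nothing is discharged.
[cite: GreenbergLNM1716, §2 Props. 2.2, 2.4 and the remark following (pp. 73–75)]
[cite: GreenbergVatsal2000, §2 p. 16 (L_𝔭) and p. 26 ("In [Gre99] … im(κ_𝔭) = L_𝔭")] -/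
theorem imKummer_ge_greenbergCondition_at_p_of_strict
    (h : imKummer_ge_strictCondition_goodOrdinary) : imKummer_ge_greenbergCondition_at_p := by
  intro W _ _ p _ hΔ hord κ hκ v hpv w hw red₀ hred₀ N hN
  obtain rfl : w = specVal v := valuation_eq_specVal v w hw
  have hred : red₀ = localRed W p hpv hΔ := eq_localRed W p hpv hΔ red₀ hred₀
  subst hred
  obtain rfl : N = reductionDatum W p hpv hΔ := eq_reductionDatum W p hpv hΔ N hN
  exact (greenbergKer_le_strictKer W p κ hκ hpv hΔ hord).trans
    (imKummer_ge_strictCondition_goodOrdinary.kerSubgroup W p hΔ hord κ hκ v hpv (specVal v)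
      (specVal_spec v) (localRed W p hpv hΔ) (localRed_apply W p hpv hΔ) (reductionDatum W p hpv hΔ)
      (mem_reductionDatum_plus_iff W p hpv hΔ) h)

end Composition

end Literature.NumberTheory.EllipticCurves.GreenbergVatsal2000.GreenbergConditionOfStrictCondition

end Part9

/-!
## Part 10 — port of `Summits/BirchSwinnertonDyer/BirchSwinnertonDyer/Theorems/PublishedInputsGreenbergVatsalLocalConditionAtPHolds.lean` (1 declarations kept)

# Greenberg–Vatsal 2000 §2 (L_𝔭 ⊆ im κ_𝔭) HOLDS: `imKummer_ge_greenbergCondition_at_p_holds` (EXACT name)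

Declarations of this Part (verbatim port; each keeps its own docstring and citation): `imKummer_ge_greenbergCondition_at_p_holds`.

Reference keys (see `references.bib` and the declarations' citations): [GreenbergVatsal2000], [GreenbergLNM1716], [CoatesGreenberg1996], [Tate1967].
-/

section Part10

set_option autoImplicit false

open scoped _root_.Classical _root_.NNReal

namespace Literature.NumberTheory.EllipticCurves.GreenbergVatsal2000

open _root_.NumberField _root_.IsDedekindDomain _root_.Field Literature.NumberTheory.GaloisRepresentations
  Literature.NumberTheory.EllipticCurves Literature.NumberTheory.EllipticCurves.GreenbergSelmer
  Literature.NumberTheory.EllipticCurves.Greenberg1999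
  Literature.NumberTheory.EllipticCurves.GreenbergVatsal2000
  Literature.NumberTheory.EllipticCurves.RibetGoodLattice.GreenbergVatsalReductionDatum
  Literature.NumberTheory.EllipticCurves.Greenberg1999
  Literature.NumberTheory.EllipticCurves.GreenbergVatsal2000.GreenbergConditionOfStrictCondition
  Literature.NumberTheory.EllipticCurves.Greenberg1999
open _root_.WeierstrassCurve (minimalDiscriminantInt)

/-- **Greenberg–Vatsal 2000 §2 p. 26 / Greenberg LNM 1716 Prop. 2.4, inertia form over `ℚ_∞`, HOLDS** (
`GreenbergVatsal2000.imKummer_ge_greenbergCondition_at_p`: for `E/ℚ` globally minimal, `p` good ordinary, the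
cyclotomic `κ`, the place `v ∋ p`, any spectral valuation / reduction map / Greenberg datum of the printed shape, every
class of `H¹(ker κ, E[p^∞])` satisfying Greenberg's inertia condition above `v` is Kummer there) — EXACT-name discharge: the
reduction `imKummer_ge_greenbergCondition_at_p_of_strict` fed `imKummer_ge_strictCondition_goodOrdinary_holds`. [cite: GreenbergVatsal2000, §2 p. 16 (L_𝔭) and p. 26] [cite: GreenbergLNM1716, §2 Props. 2.2, 2.4 (pp. 73–75)]
[cite: CoatesGreenberg1996, Cor. 3.2 and Prop. 4.3] -/
theorem imKummer_ge_greenbergCondition_at_p_holds : imKummer_ge_greenbergCondition_at_p :=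
  imKummer_ge_greenbergCondition_at_p_of_strict imKummer_ge_strictCondition_goodOrdinary_holds

end Literature.NumberTheory.EllipticCurves.GreenbergVatsal2000

end Part10

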